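import Literature.MathematicalPhysics.PowerSystems.NonuniformKuramotoPhaseCohesiveness
import Mathlib.Analysis.Convex.SpecificFunctions.Deriv
import Mathlib.Algebra.Order.BigOperators.Ring.Finset
import Mathlib.Analysis.Real.Sqrt
import Mathlib.LinearAlgebra.Matrix.PosDef
import HarnessLib

/-!
# Dörfler–Bullo synchronization condition II: phase cohesiveness from algebraic connectivity

Topic `Literature/MathematicalPhysics/PowerSystems` (LADDER-GRIDFUSION, seat gridfusion-lit-1; the
«N-independent theorem track»). Companion of `NonuniformKuramotoPhaseCohesiveness.lean` (condition I,
COMPLETE coupling graph, max-type arc length); here the CONNECTED-graph condition of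
[DorflerBullo2012, arXiv:0910.5673 §5.2 Thm 5.5 (Synchronization condition II)], whose Lyapunov function
is the smooth quadratic `𝒲(θ) = ¼ ΣᵢΣⱼ DᵢDⱼ|θᵢ − θⱼ|²` (eq. (mathcal W(theta))) and whose strength
parameter is the ALGEBRAIC CONNECTIVITY `λ₂(L(Pᵢⱼ cos φᵢⱼ))` of the lossless coupling — so sparse
(non-complete) topologies are covered.

Kernel form (certificate shape). The algebraic connectivity enters the printed proof only through
Lemma 5.9, `(Bx)ᵀ diag(Aᵢⱼ)(Bx) ≥ (λ₂(L(Aᵢⱼ))/n)‖Hx‖₂²`; we take exactly this inequality, with a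
user-supplied constant `λ`, as the HYPOTHESIS `λ·‖Hv‖₂² ≤ n·½ΣΣ Aᵢⱼ(vᵢ−vⱼ)²` (an exact `n × n` PSD
certificate `L(A) − (λ/n)·L(K_n) ⪰ 0`, i.e. `λ ≤ λ₂(L(A))`), and likewise the non-uniformity / lossy
terms through ONE data bound `M_H` (`½ΣΣ mᵢⱼ² ≤ M_H²`,
`mᵢⱼ = |ωᵢ/Dᵢ − ωⱼ/Dⱼ| + Σₖ bᵢₖ + Σₖ bⱼₖ` — an upper bound of the printed
`‖HD⁻¹ω‖₂ + X̃`; note the printed «`‖HX‖₂` is lower bounded as … `≥ X̃`» is used as an UPPER bound in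
eq. (dot W(Htheta) simplified), which is what `λ_max(HᵀH) = n` actually gives — we bound `|Xᵢ − Xⱼ|` by
`Σₖbᵢₖ + Σₖbⱼₖ` directly). The sublevel geometry `min DᵢDⱼ‖Hθ‖² ≤ 2𝒲 ≤ max DᵢDⱼ‖Hθ‖²` (eq. (bounding
of W)) replaces `α = √(min/max)` by squared inequalities, so every hypothesis is a rational inequality.

PROVED here (0 named facts):
* `pairNormSq θ = ‖Hθ‖₂² = ½ΣΣ(θᵢ−θⱼ)²`, `lyapW = 𝒲`, two-sided bounds, `(θᵢ−θⱼ)² ≤ ‖Hθ‖₂²`;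
* Lemma 5.8 (the «diagonal simplification» of `𝒲̇`, component form) and the derivative of `𝒲` along
  the non-uniform Kuramoto flow;
* the chord bound `x sin x ≥ (sin ρ/ρ) x²` on `|x| ≤ ρ ≤ π` (concavity of `sin`; printed via `sinc`);
* eq. (dot W(Htheta) simplified): `𝒲̇ ≤ max{DᵢDⱼ}·M_H·‖Hθ‖₂ − κ (sin ρ/ρ)(λ/n) ‖Hθ‖₂²` on `Δ̄(ρ)`;
* THM 5.5 statement 1) in certificate form: with `0 < μ`, `max{DᵢDⱼ}μ² ≤ 2c ≤ min{DᵢDⱼ}ρ²` and the strict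
  key inequality `max{DᵢDⱼ}·M_H < κ(λ/n)(sin ρ/ρ)·μ` (eq. (key-assumption - Kuramoto - lossless - used in
  proof)), every sublevel set `{𝒲 ≤ c}` is positively invariant (hence `‖Hθ(0)‖₂² ≤ (min/max)ρ²` ⇒
  `‖Hθ(t)‖₂ ≤ ρ` for all `t`: «phase cohesiveness»), and the ultimate bound: `{𝒲 ≤ ½max{DᵢDⱼ}μ²}`
  (⊆ `{‖Hθ‖₂² ≤ (max/min) μ²}`) is reached within the explicit time `T⋆ = (mρ² − Mμ²)/η`,
  `η = μ(κ(sin ρ/ρ)(λ/n)μ − M·M_H)`, and kept («ultimate boundedness arguments [HKK:02]»):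
  `lyapW_sublevel_invariant`, `lyapW_ultimate_bound`, `two_norm_cohesive` (printed two-norm shape,
  `α² = m/M`), `terminal_sublevel_invariant`;
* the bridge to lossless droop-controlled inverter networks on CONNECTED (sparse) graphs
  (`DroopNetwork.two_norm_cohesive`, SPDB2013 Lemma 1 with `φ = 0`);
* (append 1) THM 5.1 statement 2) in certificate form: for `φ = 0`, `P = Pᵀ`, along a trajectory in
  `Δ̄(γ)`, `γ ≤ π/2`: `Σ Dᵢθ̇ᵢ = Σ ωᵢ` (conserved), and the weighted disagreement
  `E = Σ Dᵢ(θ̇ᵢ − Ω)²`, `Ω = Σωᵢ/ΣDᵢ`, decays like `E(t) ≤ E(0)e^{−2λ_fe t}`,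
  `λ_fe = λ cos γ (ΣDᵢ)²/(n ΣDᵢ² D_max)` (`disagreement_decay`, `frequency_sync_to_syncFreq`; the
  dihedral-angle step as the rational inequality `(ΣDᵢ²)‖Hδ‖² ≥ (ΣDᵢ)²Σδᵢ²` on `Σ Dᵢδᵢ = 0`).
NOT typed: statement 2) of Thm 5.5 for `φ ≠ 0` (general frequency synchronization on sparse graphs
needs the consensus contraction of Thm 5.1 1) for a «globally reachable node»; the companion file's
`frequency_contraction` gives the complete-graph floor), the `(ρ, γ)`-optimisation at the end of the
printed proof
(`γ_min`, `γ_max` as roots of `f(ρ, γ) = 0`), Lemma 5.9 itself (replaced by the PSD hypothesis — any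
`λ` with `L(Pᵢⱼcos φᵢⱼ) − (λ/n)L(Kₙ) ⪰ 0` is admissible, `λ₂` being the largest).

## References
* [DorflerBullo2012] arXiv:0910.5673 §5.1 Thm 5.1 statement 2) + proof (eq. (rate lambda_fe)); §5.2: eq.
  (mathcal W(theta)), Thm 5.5, Remark 5.6, eq. (W(Htheta)),
  eq. (dot W(Htheta) non-simplified), Lemma 5.8, Lemma 5.9, proof of Thm 5.5 with eqs. (dot W(Htheta)
  simplified), (bounding of W), (Squeezing level sets into an interval).
* [SimpsonporcoDorflerBullo2013] arXiv:1206.5033 §3 Lemma 1 (droop-controlled inverters = non-uniform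
  Kuramoto oscillators).
-/

noncomputable section

open Set Filter Finset
open _root_.Topology

namespace Literature.MathematicalPhysics.PowerSystems

variable {n : ℕ}

/-- `‖Hθ‖₂² = ½ ΣᵢΣⱼ (θᵢ − θⱼ)²` — the squared two-norm of the vector of ALL pairwise phase differences
(`H` = incidence matrix of the complete graph). [cite: DorflerBullo2012, arXiv:0910.5673 §5.2, text
before Thm 5.5 («`‖Hθ‖₂ = (Σᵢ Σⱼ |θᵢ−θⱼ|²/2)^{1/2}`» up to the pair-counting convention) and eq. (W(Htheta))] -/
def pairNormSq (θ : Fin n → ℝ) : ℝ := 1 / 2 * ∑ i, ∑ j, (θ i - θ j) ^ 2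

/-- Every single squared phase difference is below `‖Hθ‖₂²` («`‖Hθ‖_∞ ≤ ‖Hθ‖₂`, it follows that
`θ ∈ Δ̄(ρ)`»). [cite: DorflerBullo2012, arXiv:0910.5673 §5.2 proof of Thm 5.5, first paragraph] -/
theorem sq_sub_le_pairNormSq (θ : Fin n → ℝ) (i j : Fin n) : (θ i - θ j) ^ 2 ≤ pairNormSq θ := by
  unfold pairNormSq
  rcases eq_or_ne i j with hij | hij
  · subst hij
    simp only [sub_self, ne_eq, OfNat.ofNat_ne_zero, not_false_eq_true, zero_pow]
    positivity
  · -- the terms `(i, j)` and `(j, i)` of the double sum already give `2 (θᵢ − θⱼ)²`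
    have h1 : (θ i - θ j) ^ 2 + (θ j - θ i) ^ 2 ≤ ∑ a, ∑ b, (θ a - θ b) ^ 2 := by
      have hi : ∑ b, (θ i - θ b) ^ 2 ≥ (θ i - θ j) ^ 2 :=
        Finset.single_le_sum (f := fun b => (θ i - θ b) ^ 2) (fun b _ => sq_nonneg _) (mem_univ j)
      have hj : ∑ b, (θ j - θ b) ^ 2 ≥ (θ j - θ i) ^ 2 :=
        Finset.single_le_sum (f := fun b => (θ j - θ b) ^ 2) (fun b _ => sq_nonneg _) (mem_univ i)
      have hsum : ∑ b, (θ i - θ b) ^ 2 + ∑ b, (θ j - θ b) ^ 2 ≤ ∑ a, ∑ b, (θ a - θ b) ^ 2 := by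
        have := Finset.add_le_sum (f := fun a => ∑ b, (θ a - θ b) ^ 2)
          (fun a _ => Finset.sum_nonneg fun b _ => sq_nonneg _) (mem_univ i) (mem_univ j) hij
        simpa using this
      linarith
    have h2 : (θ j - θ i) ^ 2 = (θ i - θ j) ^ 2 := by ring
    linarith

/-- Membership in `Δ̄(ρ)` from the two-norm: `‖Hθ‖₂² ≤ ρ²`, `ρ ≥ 0` ⇒ `θ ∈ Δ̄(ρ)`.
[cite: DorflerBullo2012, arXiv:0910.5673 §5.2 proof of Thm 5.5 («since `‖Hθ‖_∞ ≤ ‖Hθ‖₂`, it follows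
that `θ ∈ Δ̄(ρ)`»)] -/
theorem mem_arcPolytope_of_pairNormSq_le {θ : Fin n → ℝ} {ρ : ℝ} (hρ : 0 ≤ ρ)
    (h : pairNormSq θ ≤ ρ ^ 2) : θ ∈ arcPolytope n ρ := by
  intro i j
  have h1 := (sq_sub_le_pairNormSq θ i j).trans h
  exact abs_le_of_sq_le_sq' h1 hρ |>.2

namespace NonuniformKuramoto

variable (K : NonuniformKuramoto n)

/-- The Lyapunov function `𝒲(θ) = ¼ ΣᵢΣⱼ DᵢDⱼ |θᵢ − θⱼ|² = ½ (Hθ)ᵀ diag(DᵢDⱼ) (Hθ)`.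
[cite: DorflerBullo2012, arXiv:0910.5673 §5.2 eq. (mathcal W(theta)) and eq. (W(Htheta))] -/
def lyapW (θ : Fin n → ℝ) : ℝ := 1 / 4 * ∑ i, ∑ j, K.D i * K.D j * (θ i - θ j) ^ 2

/-- `κ := Σₖ Dₖ`. [cite: DorflerBullo2012, arXiv:0910.5673 §5.2 Thm 5.5 (definition of `κ`)] -/
def kappa : ℝ := ∑ k, K.D k

/-- **Two-sided bounds of `𝒲`** (eq. (bounding of W)):
`min{DᵢDⱼ} ‖Hθ‖₂² ≤ 2𝒲(θ) ≤ max{DᵢDⱼ} ‖Hθ‖₂²` for any bounds `m ≤ DᵢDⱼ ≤ M` over pairs `i ≠ j`.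
[cite: DorflerBullo2012, arXiv:0910.5673 §5.2 proof of Thm 5.5, eq. (bounding of W)] -/
theorem lyapW_bounds {m M : ℝ} (hm : ∀ i j, i ≠ j → m ≤ K.D i * K.D j)
    (hM : ∀ i j, i ≠ j → K.D i * K.D j ≤ M) (θ : Fin n → ℝ) :
    m * pairNormSq θ ≤ 2 * K.lyapW θ ∧ 2 * K.lyapW θ ≤ M * pairNormSq θ := by
  unfold lyapW pairNormSq
  have h1 : ∀ i j, m * (θ i - θ j) ^ 2 ≤ K.D i * K.D j * (θ i - θ j) ^ 2 := fun i j => by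
    rcases eq_or_ne i j with hij | hij
    · subst hij; simp
    · exact mul_le_mul_of_nonneg_right (hm i j hij) (sq_nonneg _)
  have h2 : ∀ i j, K.D i * K.D j * (θ i - θ j) ^ 2 ≤ M * (θ i - θ j) ^ 2 := fun i j => by
    rcases eq_or_ne i j with hij | hij
    · subst hij; simp
    · exact mul_le_mul_of_nonneg_right (hM i j hij) (sq_nonneg _)
  have hs1 : ∑ i, ∑ j, m * (θ i - θ j) ^ 2 ≤ ∑ i, ∑ j, K.D i * K.D j * (θ i - θ j) ^ 2 :=
    Finset.sum_le_sum fun i _ => Finset.sum_le_sum fun j _ => h1 i j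
  have hs2 : ∑ i, ∑ j, K.D i * K.D j * (θ i - θ j) ^ 2 ≤ ∑ i, ∑ j, M * (θ i - θ j) ^ 2 :=
    Finset.sum_le_sum fun i _ => Finset.sum_le_sum fun j _ => h2 i j
  have e1 : ∑ i, ∑ j, m * (θ i - θ j) ^ 2 = m * ∑ i, ∑ j, (θ i - θ j) ^ 2 := by
    rw [Finset.mul_sum]; exact Finset.sum_congr rfl fun i _ => by rw [Finset.mul_sum]
  have e2 : ∑ i, ∑ j, M * (θ i - θ j) ^ 2 = M * ∑ i, ∑ j, (θ i - θ j) ^ 2 := by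
    rw [Finset.mul_sum]; exact Finset.sum_congr rfl fun i _ => by rw [Finset.mul_sum]
  rw [e1] at hs1
  rw [e2] at hs2
  constructor <;> linarith

/-! ### The derivative of `𝒲` along the flow and Lemma 5.8 -/

/-- **Derivative of `𝒲` along a solution**: `d/dt 𝒲(θ(t)) = ½ ΣᵢΣⱼ DᵢDⱼ (θᵢ − θⱼ)(θ̇ᵢ − θ̇ⱼ)`
(eq. (dot W(Htheta) non-simplified) before substituting the model).
[cite: DorflerBullo2012, arXiv:0910.5673 §5.2 eq. (dot W(Htheta) non-simplified)] -/
theorem hasDerivWithinAt_lyapW {θ : ℝ → Fin n → ℝ} {T t : ℝ}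
    (hθ : HasDerivWithinAt θ (K.field (θ t)) (Icc 0 T) t) :
    HasDerivWithinAt (fun s => K.lyapW (θ s))
      (1 / 2 * ∑ i, ∑ j, K.D i * K.D j * ((θ t i - θ t j) * (K.field (θ t) i - K.field (θ t) j)))
      (Icc 0 T) t := by
  have hc := hasDerivWithinAt_pi.1 hθ
  have hsum : HasDerivWithinAt (fun s => ∑ i, ∑ j, K.D i * K.D j * (θ s i - θ s j) ^ 2)
      (∑ i, ∑ j, K.D i * K.D j * (2 * (θ t i - θ t j) * (K.field (θ t) i - K.field (θ t) j)))
      (Icc 0 T) t := by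
    refine HasDerivWithinAt.fun_sum fun i _ => HasDerivWithinAt.fun_sum fun j _ => ?_
    have h1 := (((hc i).sub (hc j)).pow 2).const_mul (K.D i * K.D j)
    refine h1.congr_deriv ?_
    simp
  have h := hsum.const_mul (1 / 4 : ℝ)
  unfold lyapW
  refine h.congr_deriv ?_
  rw [Finset.mul_sum, Finset.mul_sum]
  refine Finset.sum_congr rfl fun i _ => ?_
  rw [Finset.mul_sum, Finset.mul_sum]
  exact Finset.sum_congr rfl fun j _ => by ring

/-- Symmetrisation identity for a symmetric kernel `c` and the odd function `sin`:
`ΣᵢΣⱼ cᵢⱼ sin(θᵢ − θⱼ)(wᵢ − wⱼ) = 2 Σᵢ wᵢ Σⱼ cᵢⱼ sin(θᵢ − θⱼ)` (the index manipulation of the printed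
proof of Lemma 5.8). [cite: DorflerBullo2012, arXiv:0910.5673 §5.2 proof of Lemma 5.8 («a manipulation
of the indices in both sums»)] -/
theorem sum_sum_sin_mul_sub (c : Fin n → Fin n → ℝ) (hc : ∀ i j, c i j = c j i)
    (θ w : Fin n → ℝ) :
    ∑ i, ∑ j, c i j * Real.sin (θ i - θ j) * (w i - w j)
      = 2 * ∑ i, w i * ∑ j, c i j * Real.sin (θ i - θ j) := by
  have hanti : ∀ i j, c i j * Real.sin (θ i - θ j) = -(c j i * Real.sin (θ j - θ i)) := by
    intro i j
    rw [show θ i - θ j = -(θ j - θ i) by ring, Real.sin_neg, hc i j]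
    ring
  have hsplit : ∑ i, ∑ j, c i j * Real.sin (θ i - θ j) * (w i - w j)
      = ∑ i, ∑ j, c i j * Real.sin (θ i - θ j) * w i
        - ∑ i, ∑ j, c i j * Real.sin (θ i - θ j) * w j := by
    rw [← Finset.sum_sub_distrib]
    refine Finset.sum_congr rfl fun i _ => ?_
    rw [← Finset.sum_sub_distrib]
    exact Finset.sum_congr rfl fun j _ => by ring
  have hswap : ∑ i, ∑ j, c i j * Real.sin (θ i - θ j) * w j
      = -∑ i, ∑ j, c i j * Real.sin (θ i - θ j) * w i := by
    rw [Finset.sum_comm, ← Finset.sum_neg_distrib]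
    refine Finset.sum_congr rfl fun i _ => ?_
    rw [← Finset.sum_neg_distrib]
    refine Finset.sum_congr rfl fun j _ => ?_
    rw [hanti j i]
    ring
  have hfactor : ∑ i, ∑ j, c i j * Real.sin (θ i - θ j) * w i
      = ∑ i, w i * ∑ j, c i j * Real.sin (θ i - θ j) := by
    refine Finset.sum_congr rfl fun i _ => ?_
    rw [Finset.mul_sum]
    exact Finset.sum_congr rfl fun j _ => by ring
  rw [hsplit, hswap, hfactor]
  ring

/-- **Lemma 5.8 (the diagonal simplification), component form.** For symmetric lossless weights
`cᵢⱼ = Pᵢⱼ cos φᵢⱼ` and `Sᵢ := Σₖ cᵢₖ sin(θᵢ − θₖ)`: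
`½ ΣᵢΣⱼ (θᵢ − θⱼ)(Dⱼ Sᵢ − Dᵢ Sⱼ) = κ · ½ ΣᵢΣₖ cᵢₖ (θᵢ − θₖ) sin(θᵢ − θₖ)`, `κ = Σₖ Dₖ` — i.e.
`(Hθ)ᵀdiag(DᵢDⱼ)HD⁻¹Hᵀdiag(cᵢⱼ) sin(Hθ) = κ (Hθ)ᵀ diag(cᵢⱼ) sin(Hθ)`.
[cite: DorflerBullo2012, arXiv:0910.5673 §5.2 Lemma 5.8, eq. (identity for dot W)] -/
theorem diagonal_simplification (c : Fin n → Fin n → ℝ) (hc : ∀ i j, c i j = c j i)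
    (θ : Fin n → ℝ) :
    1 / 2 * ∑ i, ∑ j, (θ i - θ j) *
        (K.D j * ∑ k, c i k * Real.sin (θ i - θ k) - K.D i * ∑ k, c j k * Real.sin (θ j - θ k))
      = K.kappa * (1 / 2 * ∑ i, ∑ k, c i k * (θ i - θ k) * Real.sin (θ i - θ k)) := by
  set S : Fin n → ℝ := fun i => ∑ k, c i k * Real.sin (θ i - θ k) with hS
  -- (a) the two halves are equal: ½ ΣΣ (θᵢ−θⱼ)(Dⱼ Sᵢ − Dᵢ Sⱼ) = ΣΣ (θᵢ − θⱼ) Dⱼ Sᵢ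
  have ha : ∑ i, ∑ j, (θ i - θ j) * (K.D j * S i - K.D i * S j)
      = 2 * ∑ i, ∑ j, (θ i - θ j) * K.D j * S i := by
    have h1 : ∑ i, ∑ j, (θ i - θ j) * (K.D j * S i - K.D i * S j)
        = ∑ i, ∑ j, (θ i - θ j) * K.D j * S i - ∑ i, ∑ j, (θ i - θ j) * K.D i * S j := by
      rw [← Finset.sum_sub_distrib]
      refine Finset.sum_congr rfl fun i _ => ?_
      rw [← Finset.sum_sub_distrib]
      exact Finset.sum_congr rfl fun j _ => by ring
    have h2 : ∑ i, ∑ j, (θ i - θ j) * K.D i * S j = -∑ i, ∑ j, (θ i - θ j) * K.D j * S i := by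
      rw [Finset.sum_comm, ← Finset.sum_neg_distrib]
      refine Finset.sum_congr rfl fun i _ => ?_
      rw [← Finset.sum_neg_distrib]
      exact Finset.sum_congr rfl fun j _ => by ring
    rw [h1, h2]
    ring
  -- (b) ΣΣ (θᵢ − θⱼ) Dⱼ Sᵢ = κ Σᵢ θᵢ Sᵢ − (Σⱼ Dⱼθⱼ)(Σᵢ Sᵢ)
  have hb : ∑ i, ∑ j, (θ i - θ j) * K.D j * S i
      = K.kappa * ∑ i, θ i * S i - (∑ j, K.D j * θ j) * ∑ i, S i := by
    unfold kappa
    have : ∀ i, ∑ j, (θ i - θ j) * K.D j * S i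
        = (∑ j, K.D j) * (θ i * S i) - (∑ j, K.D j * θ j) * S i := fun i => by
      rw [Finset.sum_mul, Finset.sum_mul, ← Finset.sum_sub_distrib]
      exact Finset.sum_congr rfl fun j _ => by ring
    simp_rw [this]
    rw [Finset.sum_sub_distrib, ← Finset.mul_sum, ← Finset.mul_sum]
  -- (c) Σᵢ Sᵢ = 0 (c symmetric, sin odd)
  have hc0 : ∑ i, S i = 0 := by
    have h := sum_sum_sin_mul_sub c hc θ (fun _ => (1 : ℝ))
    simp only [sub_self, mul_zero, Finset.sum_const_zero, one_mul] at h
    simp only [hS]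
    linarith
  -- (d) Σᵢ θᵢ Sᵢ = ½ ΣΣ cᵢₖ (θᵢ − θₖ) sin(θᵢ − θₖ)
  have hd : ∑ i, θ i * S i = 1 / 2 * ∑ i, ∑ k, c i k * (θ i - θ k) * Real.sin (θ i - θ k) := by
    have h := sum_sum_sin_mul_sub c hc θ θ
    have h' : ∑ i, ∑ k, c i k * (θ i - θ k) * Real.sin (θ i - θ k)
        = ∑ i, ∑ j, c i j * Real.sin (θ i - θ j) * (θ i - θ j) :=
      Finset.sum_congr rfl fun i _ => Finset.sum_congr rfl fun j _ => by ring
    rw [h', h]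
    simp only [hS]
    ring
  calc 1 / 2 * ∑ i, ∑ j, (θ i - θ j) *
        (K.D j * ∑ k, c i k * Real.sin (θ i - θ k) - K.D i * ∑ k, c j k * Real.sin (θ j - θ k))
      = 1 / 2 * ∑ i, ∑ j, (θ i - θ j) * (K.D j * S i - K.D i * S j) := by simp only [hS]
    _ = ∑ i, ∑ j, (θ i - θ j) * K.D j * S i := by rw [ha]; ring
    _ = K.kappa * ∑ i, θ i * S i := by rw [hb, hc0]; ring
    _ = K.kappa * (1 / 2 * ∑ i, ∑ k, c i k * (θ i - θ k) * Real.sin (θ i - θ k)) := by rw [hd]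

/-- **`𝒲̇` decomposed** (eq. (dot W(Htheta) non-simplified) with Lemma 5.8 substituted): with
`uᵢ := ωᵢ/Dᵢ − Xᵢ`, `Xᵢ = Σₖ bᵢₖ cos(θᵢ − θₖ)`, and the lossless symmetric kernel `cᵢⱼ = Dᵢ aᵢⱼ`
(`= Pᵢⱼ cos φᵢⱼ`, assumed symmetric), the derivative of `𝒲` along the flow equals
`½ ΣᵢΣⱼ DᵢDⱼ(θᵢ − θⱼ)(uᵢ − uⱼ) − κ · ½ ΣᵢΣⱼ cᵢⱼ (θᵢ − θⱼ) sin(θᵢ − θⱼ)`.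
[cite: DorflerBullo2012, arXiv:0910.5673 §5.2 eq. (dot W(Htheta) non-simplified) and Lemma 5.8] -/
theorem lyapW_deriv_eq (hD : ∀ i, K.D i ≠ 0)
    (hsymm : ∀ i j, K.P i j * Real.cos (K.φ i j) = K.P j i * Real.cos (K.φ j i)) (θ : Fin n → ℝ) :
    1 / 2 * ∑ i, ∑ j, K.D i * K.D j * ((θ i - θ j) * (K.field θ i - K.field θ j))
      = 1 / 2 * ∑ i, ∑ j, K.D i * K.D j * ((θ i - θ j) *
          ((K.ω i / K.D i - ∑ k, K.b i k * Real.cos (θ i - θ k))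
            - (K.ω j / K.D j - ∑ k, K.b j k * Real.cos (θ j - θ k))))
        - K.kappa * (1 / 2 * ∑ i, ∑ k, K.P i k * Real.cos (K.φ i k) * (θ i - θ k)
            * Real.sin (θ i - θ k)) := by
  -- `fᵢ = uᵢ − Sᵢ/Dᵢ` with `Sᵢ = Σₖ Pᵢₖ cos φᵢₖ sin(θᵢ − θₖ)`
  have hf : ∀ i, K.field θ i = (K.ω i / K.D i - ∑ k, K.b i k * Real.cos (θ i - θ k))
      - (∑ k, K.P i k * Real.cos (K.φ i k) * Real.sin (θ i - θ k)) / K.D i := by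
    intro i
    rw [K.field_eq_expanded θ i, Finset.sum_add_distrib, Finset.sum_div]
    have : ∑ k, K.a i k * Real.sin (θ i - θ k)
        = ∑ k, K.P i k * Real.cos (K.φ i k) * Real.sin (θ i - θ k) / K.D i :=
      Finset.sum_congr rfl fun k _ => by unfold a; ring
    rw [this]
    ring
  have hkey := K.diagonal_simplification (fun i j => K.P i j * Real.cos (K.φ i j)) hsymm θ
  -- expand both sides termwise
  have hterm : ∀ i j, K.D i * K.D j * ((θ i - θ j) * (K.field θ i - K.field θ j))
      = K.D i * K.D j * ((θ i - θ j) *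
          ((K.ω i / K.D i - ∑ k, K.b i k * Real.cos (θ i - θ k))
            - (K.ω j / K.D j - ∑ k, K.b j k * Real.cos (θ j - θ k))))
        - (θ i - θ j) * (K.D j * ∑ k, K.P i k * Real.cos (K.φ i k) * Real.sin (θ i - θ k)
            - K.D i * ∑ k, K.P j k * Real.cos (K.φ j k) * Real.sin (θ j - θ k)) := by
    intro i j
    rw [hf i, hf j]
    field_simp [hD i, hD j]
    ring
  have hL : ∑ i, ∑ j, K.D i * K.D j * ((θ i - θ j) * (K.field θ i - K.field θ j))
      = ∑ i, ∑ j, K.D i * K.D j * ((θ i - θ j) *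
          ((K.ω i / K.D i - ∑ k, K.b i k * Real.cos (θ i - θ k))
            - (K.ω j / K.D j - ∑ k, K.b j k * Real.cos (θ j - θ k))))
        - ∑ i, ∑ j, (θ i - θ j) * (K.D j * ∑ k, K.P i k * Real.cos (K.φ i k) * Real.sin (θ i - θ k)
            - K.D i * ∑ k, K.P j k * Real.cos (K.φ j k) * Real.sin (θ j - θ k)) := by
    rw [← Finset.sum_sub_distrib]
    refine Finset.sum_congr rfl fun i _ => ?_
    rw [← Finset.sum_sub_distrib]
    exact Finset.sum_congr rfl fun j _ => hterm i j
  rw [hL, mul_sub, hkey]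

/-! ### The two estimates: chord (`sinc`) bound and Cauchy–Schwarz -/

/-- Chord bound for the sine (the printed `sinc` estimate «`1 ≥ sinc(θᵢ−θⱼ) ≥ sinc(ρ)` … thus
`(θᵢ−θⱼ) sin(θᵢ−θⱼ) ≥ (θᵢ−θⱼ)² sinc(ρ)`»): for `0 < ρ ≤ π` and `|x| ≤ ρ`,
`(sin ρ/ρ)·x² ≤ x·sin x` — from the concavity of `sin` on `[0, π]` (Mathlib `strictConcaveOn_sin_Icc`)
and oddness. [cite: DorflerBullo2012, arXiv:0910.5673 §5.2 proof of Thm 5.5, first display] -/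
theorem sinc_mul_sq_le_mul_sin {ρ x : ℝ} (hρ0 : 0 < ρ) (hρπ : ρ ≤ Real.pi) (hx : |x| ≤ ρ) :
    Real.sin ρ / ρ * x ^ 2 ≤ x * Real.sin x := by
  -- the chord inequality on `[0, ρ]`: `(y/ρ) sin ρ ≤ sin y`
  have chord : ∀ y, 0 ≤ y → y ≤ ρ → y / ρ * Real.sin ρ ≤ Real.sin y := by
    intro y hy0 hyρ
    have hconc := strictConcaveOn_sin_Icc.concaveOn
    have h0 : (0 : ℝ) ∈ Icc 0 Real.pi := ⟨le_rfl, Real.pi_pos.le⟩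
    have hρm : ρ ∈ Icc 0 Real.pi := ⟨hρ0.le, hρπ⟩
    have ha : 0 ≤ 1 - y / ρ := by
      rw [sub_nonneg, div_le_one hρ0]; exact hyρ
    have hb : 0 ≤ y / ρ := div_nonneg hy0 hρ0.le
    have h := hconc.2 h0 hρm ha hb (by ring)
    simp only [smul_eq_mul, mul_zero, Real.sin_zero, zero_add] at h
    rw [div_mul_cancel₀ y hρ0.ne'] at h
    exact h
  rcases le_or_gt 0 x with hx0 | hx0
  · -- `x ≥ 0`
    have hxρ : x ≤ ρ := (le_abs_self x).trans hx
    have h := chord x hx0 hxρ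
    have : Real.sin ρ / ρ * x ^ 2 = x * (x / ρ * Real.sin ρ) := by ring
    rw [this]
    exact mul_le_mul_of_nonneg_left h hx0
  · -- `x < 0`: apply the chord bound to `−x`
    have hxρ : -x ≤ ρ := (neg_le_abs x).trans hx
    have h := chord (-x) (by linarith) hxρ
    rw [Real.sin_neg] at h
    have : Real.sin ρ / ρ * x ^ 2 = (-x) * (-x / ρ * Real.sin ρ) := by ring
    rw [this]
    have h2 : (-x) * (-x / ρ * Real.sin ρ) ≤ (-x) * (-Real.sin x) :=
      mul_le_mul_of_nonneg_left h (by linarith)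
    linarith [h2]

/-- Cauchy–Schwarz over all ordered pairs: if `|uᵢ − uⱼ| ≤ mᵢⱼ`, `DᵢDⱼ ≤ M` (`i ≠ j`, `M ≥ 0`) and
`½ΣΣ mᵢⱼ² ≤ M_H²` (`M_H ≥ 0`), then `½ ΣᵢΣⱼ DᵢDⱼ (θᵢ − θⱼ)(uᵢ − uⱼ) ≤ M · M_H · √(‖Hθ‖₂²)` — the
first two terms of eq. (dot W(Htheta) simplified) («`≤ ‖Hθ‖₂ max{DᵢDⱼ}(‖HD⁻¹ω‖₂ + X̃)`»).
[cite: DorflerBullo2012, arXiv:0910.5673 §5.2 proof of Thm 5.5, eq. (dot W(Htheta) simplified)] -/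
theorem cross_term_le (hD : ∀ i, 0 < K.D i) {M MH : ℝ} (hM0 : 0 ≤ M)
    (hM : ∀ i j, i ≠ j → K.D i * K.D j ≤ M)
    (hMH0 : 0 ≤ MH) {θ u : Fin n → ℝ} {m : Fin n → Fin n → ℝ} (hm : ∀ i j, |u i - u j| ≤ m i j)
    (hMH : 1 / 2 * ∑ i, ∑ j, m i j ^ 2 ≤ MH ^ 2) :
    1 / 2 * ∑ i, ∑ j, K.D i * K.D j * ((θ i - θ j) * (u i - u j))
      ≤ M * MH * Real.sqrt (pairNormSq θ) := by
  -- termwise: DᵢDⱼ(θᵢ−θⱼ)(uᵢ−uⱼ) ≤ M |θᵢ−θⱼ| mᵢⱼ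
  have hterm : ∀ i j, K.D i * K.D j * ((θ i - θ j) * (u i - u j)) ≤ M * (|θ i - θ j| * m i j) := by
    intro i j
    rcases eq_or_ne i j with hij | hij
    · subst hij
      have : 0 ≤ m i i := (abs_nonneg _).trans (hm i i)
      simp only [sub_self, zero_mul, mul_zero, abs_zero]
      exact le_rfl
    · have h1 : (θ i - θ j) * (u i - u j) ≤ |θ i - θ j| * m i j := by
        calc (θ i - θ j) * (u i - u j) ≤ |(θ i - θ j) * (u i - u j)| := le_abs_self _
          _ = |θ i - θ j| * |u i - u j| := abs_mul _ _
          _ ≤ |θ i - θ j| * m i j := mul_le_mul_of_nonneg_left (hm i j) (abs_nonneg _)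
      have h2 : 0 ≤ |θ i - θ j| * m i j :=
        mul_nonneg (abs_nonneg _) ((abs_nonneg _).trans (hm i j))
      calc K.D i * K.D j * ((θ i - θ j) * (u i - u j))
          ≤ K.D i * K.D j * (|θ i - θ j| * m i j) :=
            mul_le_mul_of_nonneg_left h1 (mul_pos (hD i) (hD j)).le
        _ ≤ M * (|θ i - θ j| * m i j) := mul_le_mul_of_nonneg_right (hM i j hij) h2
  have hsum : ∑ i, ∑ j, K.D i * K.D j * ((θ i - θ j) * (u i - u j))
      ≤ M * ∑ i, ∑ j, |θ i - θ j| * m i j := by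
    rw [Finset.mul_sum]
    refine Finset.sum_le_sum fun i _ => ?_
    rw [Finset.mul_sum]
    exact Finset.sum_le_sum fun j _ => hterm i j
  -- Cauchy–Schwarz on the product index set
  have hCS : (∑ i, ∑ j, |θ i - θ j| * m i j) ^ 2
      ≤ (∑ i, ∑ j, (θ i - θ j) ^ 2) * ∑ i, ∑ j, m i j ^ 2 := by
    have h := Finset.sum_mul_sq_le_sq_mul_sq (Finset.univ : Finset (Fin n × Fin n))
      (fun p => |θ p.1 - θ p.2|) (fun p => m p.1 p.2)
    simp only [Fintype.sum_prod_type, sq_abs] at h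
    exact h
  have hA0 : 0 ≤ ∑ i, ∑ j, |θ i - θ j| * m i j :=
    Finset.sum_nonneg fun i _ => Finset.sum_nonneg fun j _ =>
      mul_nonneg (abs_nonneg _) ((abs_nonneg _).trans (hm i j))
  have hP0 : 0 ≤ pairNormSq θ := by
    unfold pairNormSq
    exact mul_nonneg (by norm_num) (Finset.sum_nonneg fun i _ => Finset.sum_nonneg fun j _ =>
      sq_nonneg _)
  -- `A ≤ 2 √(pairNormSq) · M_H`
  have hA : ∑ i, ∑ j, |θ i - θ j| * m i j ≤ 2 * Real.sqrt (pairNormSq θ) * MH := by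
    have hsq : (∑ i, ∑ j, |θ i - θ j| * m i j) ^ 2 ≤ (2 * Real.sqrt (pairNormSq θ) * MH) ^ 2 := by
      have e1 : ∑ i, ∑ j, (θ i - θ j) ^ 2 = 2 * pairNormSq θ := by unfold pairNormSq; ring
      have e2 : ∑ i, ∑ j, m i j ^ 2 ≤ 2 * MH ^ 2 := by linarith
      calc (∑ i, ∑ j, |θ i - θ j| * m i j) ^ 2
          ≤ (∑ i, ∑ j, (θ i - θ j) ^ 2) * ∑ i, ∑ j, m i j ^ 2 := hCS
        _ ≤ (2 * pairNormSq θ) * (2 * MH ^ 2) := by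
            rw [e1]
            exact mul_le_mul_of_nonneg_left e2 (by linarith)
        _ = (2 * Real.sqrt (pairNormSq θ) * MH) ^ 2 := by
            rw [mul_pow, mul_pow, Real.sq_sqrt hP0]; ring
    exact abs_le_of_sq_le_sq' hsq (by positivity) |>.2
  calc 1 / 2 * ∑ i, ∑ j, K.D i * K.D j * ((θ i - θ j) * (u i - u j))
      ≤ 1 / 2 * (M * ∑ i, ∑ j, |θ i - θ j| * m i j) := by linarith
    _ ≤ 1 / 2 * (M * (2 * Real.sqrt (pairNormSq θ) * MH)) := by
        have := mul_le_mul_of_nonneg_left hA hM0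
        linarith
    _ = M * MH * Real.sqrt (pairNormSq θ) := by ring

/-! ### The derivative estimate (eq. (dot W(Htheta) simplified)) -/

/-- The data bound `mᵢⱼ := |ωᵢ/Dᵢ − ωⱼ/Dⱼ| + Σₖ bᵢₖ + Σₖ bⱼₖ` dominates the pairwise differences of
`uᵢ = ωᵢ/Dᵢ − Xᵢ`, `Xᵢ = Σₖ bᵢₖ cos(θᵢ − θₖ)` (`bᵢₖ ≥ 0`, `|cos| ≤ 1`) — our replacement for the printed
`‖HD⁻¹ω‖₂ + X̃`. [cite: DorflerBullo2012, arXiv:0910.5673 §5.2 proof of Thm 5.5 (the vector `X` of lossy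
coupling and its bound `X̃`)] -/
theorem abs_u_sub_le (hb : ∀ i j, 0 ≤ K.b i j) (θ : Fin n → ℝ) (i j : Fin n) :
    |(K.ω i / K.D i - ∑ k, K.b i k * Real.cos (θ i - θ k))
        - (K.ω j / K.D j - ∑ k, K.b j k * Real.cos (θ j - θ k))|
      ≤ |K.ω i / K.D i - K.ω j / K.D j| + ∑ k, K.b i k + ∑ k, K.b j k := by
  have hX : ∀ i, |∑ k, K.b i k * Real.cos (θ i - θ k)| ≤ ∑ k, K.b i k := fun i => by
    refine (Finset.abs_sum_le_sum_abs _ _).trans (Finset.sum_le_sum fun k _ => ?_)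
    rw [abs_mul, abs_of_nonneg (hb i k)]
    exact mul_le_of_le_one_right (hb i k) (Real.abs_cos_le_one _)
  have h1 := hX i
  have h2 := hX j
  have hsplit : (K.ω i / K.D i - ∑ k, K.b i k * Real.cos (θ i - θ k))
        - (K.ω j / K.D j - ∑ k, K.b j k * Real.cos (θ j - θ k))
      = (K.ω i / K.D i - K.ω j / K.D j) - ∑ k, K.b i k * Real.cos (θ i - θ k)
        + ∑ k, K.b j k * Real.cos (θ j - θ k) := by ring
  rw [hsplit]
  calc |K.ω i / K.D i - K.ω j / K.D j - ∑ k, K.b i k * Real.cos (θ i - θ k)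
          + ∑ k, K.b j k * Real.cos (θ j - θ k)|
      ≤ |K.ω i / K.D i - K.ω j / K.D j - ∑ k, K.b i k * Real.cos (θ i - θ k)|
          + |∑ k, K.b j k * Real.cos (θ j - θ k)| := abs_add_le _ _
    _ ≤ |K.ω i / K.D i - K.ω j / K.D j| + |∑ k, K.b i k * Real.cos (θ i - θ k)|
          + |∑ k, K.b j k * Real.cos (θ j - θ k)| := by
        linarith [abs_sub (K.ω i / K.D i - K.ω j / K.D j) (∑ k, K.b i k * Real.cos (θ i - θ k))]
    _ ≤ _ := by linarith

/-- **eq. (dot W(Htheta) simplified)** in certificate form: on `Δ̄(ρ)`, `0 < ρ ≤ π`, with parameters as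
printed (`Dᵢ > 0`, `Pᵢⱼ ≥ 0`, `φᵢⱼ ∈ [0, π/2]`, `Pᵢⱼ cos φᵢⱼ` symmetric), a pair-product bound
`DᵢDⱼ ≤ M` (`i ≠ j`, `M ≥ 0`), the data bound `½ΣΣmᵢⱼ² ≤ M_H²` and the connectivity certificate
`λ‖Hv‖₂² ≤ n·½ΣΣ Pᵢⱼcos φᵢⱼ (vᵢ−vⱼ)²` for all `v` (this is Lemma 5.9, for any
`λ ≤ λ₂(L(Pᵢⱼ cos φᵢⱼ))`): `𝒲̇ ≤ M·M_H·‖Hθ‖₂ − κ (sin ρ/ρ)(λ/n) ‖Hθ‖₂²`.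
[cite: DorflerBullo2012, arXiv:0910.5673 §5.2 proof of Thm 5.5, eq. (dot W(Htheta) simplified), via
Lemma 5.8 and Lemma 5.9] -/
theorem lyapW_deriv_le (hD : ∀ i, 0 < K.D i) (hP : ∀ i j, 0 ≤ K.P i j)
    (hφ0 : ∀ i j, 0 ≤ K.φ i j) (hφ : ∀ i j, K.φ i j ≤ Real.pi / 2)
    (hsymm : ∀ i j, K.P i j * Real.cos (K.φ i j) = K.P j i * Real.cos (K.φ j i))
    {ρ M MH lam : ℝ} (hρ0 : 0 < ρ) (hρπ : ρ ≤ Real.pi) (hM : ∀ i j, i ≠ j → K.D i * K.D j ≤ M)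
    (hM0 : 0 ≤ M) (hMH0 : 0 ≤ MH)
    (hMH : 1 / 2 * ∑ i, ∑ j,
      (|K.ω i / K.D i - K.ω j / K.D j| + ∑ k, K.b i k + ∑ k, K.b j k) ^ 2 ≤ MH ^ 2)
    (hlam : ∀ v : Fin n → ℝ, lam * pairNormSq v
      ≤ n * (1 / 2 * ∑ i, ∑ j, K.P i j * Real.cos (K.φ i j) * (v i - v j) ^ 2))
    {θ : Fin n → ℝ} (hθ : θ ∈ arcPolytope n ρ) :
    1 / 2 * ∑ i, ∑ j, K.D i * K.D j * ((θ i - θ j) * (K.field θ i - K.field θ j))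
      ≤ M * MH * Real.sqrt (pairNormSq θ)
        - K.kappa * (Real.sin ρ / ρ) * (lam / n) * pairNormSq θ := by
  have hb : ∀ i j, 0 ≤ K.b i j := fun i j => (K.a_nonneg_b_nonneg hD hP hφ0 hφ i j).2
  rw [K.lyapW_deriv_eq (fun i => (hD i).ne') hsymm θ]
  -- first term: Cauchy–Schwarz
  have h1 := K.cross_term_le hD hM0 hM hMH0 (θ := θ)
    (u := fun i => K.ω i / K.D i - ∑ k, K.b i k * Real.cos (θ i - θ k))
    (m := fun i j => |K.ω i / K.D i - K.ω j / K.D j| + ∑ k, K.b i k + ∑ k, K.b j k)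
    (fun i j => K.abs_u_sub_le hb θ i j) hMH
  -- second term: chord bound, then the connectivity certificate
  have hc0 : ∀ i j, 0 ≤ K.P i j * Real.cos (K.φ i j) := fun i j =>
    mul_nonneg (hP i j) (Real.cos_nonneg_of_neg_pi_div_two_le_of_le
      (by linarith [hφ0 i j, Real.pi_pos]) (hφ i j))
  have hsinc0 : 0 ≤ Real.sin ρ / ρ :=
    div_nonneg (Real.sin_nonneg_of_nonneg_of_le_pi hρ0.le hρπ) hρ0.le
  have hκ0 : 0 ≤ K.kappa := Finset.sum_nonneg fun k _ => (hD k).le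
  have h2 : Real.sin ρ / ρ * (1 / 2 * ∑ i, ∑ j, K.P i j * Real.cos (K.φ i j) * (θ i - θ j) ^ 2)
      ≤ 1 / 2 * ∑ i, ∑ k, K.P i k * Real.cos (K.φ i k) * (θ i - θ k) * Real.sin (θ i - θ k) := by
    rw [← mul_assoc, mul_comm (Real.sin ρ / ρ) (1 / 2), mul_assoc, Finset.mul_sum]
    refine mul_le_mul_of_nonneg_left (Finset.sum_le_sum fun i _ => ?_) (by norm_num)
    rw [Finset.mul_sum]
    refine Finset.sum_le_sum fun j _ => ?_
    have hij : |θ i - θ j| ≤ ρ := abs_sub_le_iff.2 ⟨hθ i j, hθ j i⟩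
    have hs := sinc_mul_sq_le_mul_sin hρ0 hρπ hij
    have hs' := mul_le_mul_of_nonneg_left hs (hc0 i j)
    nlinarith [hs']
  have h3 : lam / n * pairNormSq θ
      ≤ 1 / 2 * ∑ i, ∑ j, K.P i j * Real.cos (K.φ i j) * (θ i - θ j) ^ 2 := by
    rcases Nat.eq_zero_or_pos n with hn | hn
    · subst hn
      simp [pairNormSq]
    · have hn' : (0 : ℝ) < n := by exact_mod_cast hn
      rw [div_mul_eq_mul_div, div_le_iff₀ hn']
      have := hlam θ
      linarith
  have h4 : K.kappa * (Real.sin ρ / ρ) * (lam / n) * pairNormSq θ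
      ≤ K.kappa * (1 / 2 * ∑ i, ∑ k, K.P i k * Real.cos (K.φ i k) * (θ i - θ k)
          * Real.sin (θ i - θ k)) := by
    have step : Real.sin ρ / ρ * (lam / n * pairNormSq θ)
        ≤ 1 / 2 * ∑ i, ∑ k, K.P i k * Real.cos (K.φ i k) * (θ i - θ k) * Real.sin (θ i - θ k) :=
      (mul_le_mul_of_nonneg_left h3 hsinc0).trans h2
    have := mul_le_mul_of_nonneg_left step hκ0
    linarith [this]
  linarith

/-! ### Theorem 5.5, statement 1): invariance and ultimate boundedness (certificate form) -/

/-- Scalar face step: for `0 ≤ B`, `0 < μ ≤ s` and `A < Bμ`, `A s − B s² ≤ μ (A − B μ)`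
(`= (s − μ)(A − B(s + μ)) ≤ 0` rearranged). [folklore] -/
private theorem face_scalar {A B μ s : ℝ} (hB : 0 ≤ B) (hμ : 0 < μ) (hs : μ ≤ s)
    (hkey : A < B * μ) : A * s - B * (s * s) ≤ μ * (A - B * μ) := by
  have h1 : 0 ≤ s - μ := sub_nonneg.2 hs
  have h2 : 0 ≤ B * (s + μ) - A := by
    nlinarith [mul_nonneg hB (le_of_lt (lt_of_lt_of_le hμ hs))]
  nlinarith [mul_nonneg h1 h2]

/-- **Synchronization condition II — positive invariance of the `𝒲`-sublevel sets.** Parameters as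
printed (`Dᵢ > 0`, `Pᵢⱼ ≥ 0`, `φᵢⱼ ∈ [0, π/2]`, `Pᵢⱼ cos φᵢⱼ` symmetric), pair-product bounds
`0 < m ≤ DᵢDⱼ ≤ M` (`i ≠ j`), radii `0 < μ`, `0 < ρ ≤ π` and a level `c` squeezed as in eq. (Squeezing
level sets into an interval): `M μ² ≤ 2c ≤ m ρ²` (so `{𝒲 ≤ c} ⊆ {‖Hθ‖₂ ≤ ρ}` and the level surface
`{𝒲 = c}` lies in `{‖Hθ‖₂ ≥ μ}`), the data bound `M_H`, the connectivity certificate `λ`, and the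
STRICT key inequality `M·M_H < κ (sin ρ/ρ)(λ/n) μ` (eq. (key-assumption - Kuramoto - lossless - used in
proof): `μ > μ_c`). Then along every solution on `[0, T]` (tree convention) starting in `{𝒲 ≤ c}` one has
`𝒲(θ(t)) ≤ c`, hence `‖Hθ(t)‖₂² ≤ ρ²` and `θ(t) ∈ Δ̄(ρ)` for all `t` — the phase-cohesiveness statement
of Thm 5.5 1) (the printed `‖Hθ(0)‖₂ ≤ αρ`, `α = √(m/M)`, is `M‖Hθ(0)‖₂² ≤ mρ²`, which gives
`𝒲(θ(0)) ≤ ½mρ²`; take `c = ½mρ²`). [cite: DorflerBullo2012, arXiv:0910.5673 §5.2 Thm 5.5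
(Synchronization condition II) statement 1) and its proof (eqs. (dot W(Htheta) simplified), (bounding of
W), (Squeezing level sets into an interval))] -/
theorem lyapW_sublevel_invariant (hD : ∀ i, 0 < K.D i) (hP : ∀ i j, 0 ≤ K.P i j)
    (hφ0 : ∀ i j, 0 ≤ K.φ i j) (hφ : ∀ i j, K.φ i j ≤ Real.pi / 2)
    (hsymm : ∀ i j, K.P i j * Real.cos (K.φ i j) = K.P j i * Real.cos (K.φ j i))
    {ρ μ m M MH lam c T : ℝ} (hρ0 : 0 < ρ) (hρπ : ρ ≤ Real.pi) (hμ : 0 < μ)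
    (hm0 : 0 < m) (hm : ∀ i j, i ≠ j → m ≤ K.D i * K.D j) (hM : ∀ i j, i ≠ j → K.D i * K.D j ≤ M)
    (hc1 : M * μ ^ 2 ≤ 2 * c) (hc2 : 2 * c ≤ m * ρ ^ 2) (hMH0 : 0 ≤ MH)
    (hMH : 1 / 2 * ∑ i, ∑ j,
      (|K.ω i / K.D i - K.ω j / K.D j| + ∑ k, K.b i k + ∑ k, K.b j k) ^ 2 ≤ MH ^ 2)
    (hlam0 : 0 ≤ lam)
    (hlam : ∀ v : Fin n → ℝ, lam * pairNormSq v
      ≤ n * (1 / 2 * ∑ i, ∑ j, K.P i j * Real.cos (K.φ i j) * (v i - v j) ^ 2))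
    (hkey : M * MH < K.kappa * (Real.sin ρ / ρ) * (lam / n) * μ)
    {θ : ℝ → Fin n → ℝ} (hθ : ∀ t ∈ Icc 0 T, HasDerivWithinAt θ (K.field (θ t)) (Icc 0 T) t)
    (h0 : K.lyapW (θ 0) ≤ c) :
    ∀ t ∈ Icc 0 T, K.lyapW (θ t) ≤ c ∧ pairNormSq (θ t) ≤ ρ ^ 2 ∧ θ t ∈ arcPolytope n ρ := by
  -- from `𝒲 ≤ c` to `‖Hθ‖₂² ≤ ρ²` and `Δ̄(ρ)`
  have hgeom : ∀ ψ : Fin n → ℝ, K.lyapW ψ ≤ c → pairNormSq ψ ≤ ρ ^ 2 ∧ ψ ∈ arcPolytope n ρ := by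
    intro ψ hψ
    have hlow := (K.lyapW_bounds hm hM ψ).1
    have hPρ : pairNormSq ψ ≤ ρ ^ 2 := by
      by_contra hlt
      push Not at hlt
      have : m * ρ ^ 2 < m * pairNormSq ψ := mul_lt_mul_of_pos_left hlt hm0
      linarith
    exact ⟨hPρ, mem_arcPolytope_of_pairNormSq_le hρ0.le hPρ⟩
  -- no distinct pair of indices: `𝒲 ≡ 0` and there is nothing to do
  by_cases hpair : ∃ i j : Fin n, i ≠ j
  swap
  · push Not at hpair
    have hW0 : ∀ ψ : Fin n → ℝ, K.lyapW ψ = 0 := fun ψ => by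
      unfold lyapW
      rw [Finset.sum_eq_zero fun i _ => Finset.sum_eq_zero fun j _ => by
        rw [hpair i j, sub_self]; ring]
      ring
    intro t _
    have hct : K.lyapW (θ t) ≤ c := by rw [hW0]; rw [hW0] at h0; exact h0
    exact ⟨hct, hgeom _ hct⟩
  obtain ⟨i₀, j₀, hij₀⟩ := hpair
  have hM0 : 0 < M := lt_of_lt_of_le (mul_pos (hD i₀) (hD j₀)) (hM i₀ j₀ hij₀)
  have hB0 : 0 ≤ K.kappa * (Real.sin ρ / ρ) * (lam / n) := by
    have hκ0 : 0 ≤ K.kappa := Finset.sum_nonneg fun k _ => (hD k).le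
    have hsinc0 : 0 ≤ Real.sin ρ / ρ :=
      div_nonneg (Real.sin_nonneg_of_nonneg_of_le_pi hρ0.le hρπ) hρ0.le
    have : 0 ≤ lam / n := div_nonneg hlam0 (Nat.cast_nonneg n)
    positivity
  -- the single barrier `𝒲(θ(t)) ≤ c`
  have key := Literature.Analysis.ODE.forall_le_of_hasDerivWithinAt_of_eq_imp_deriv_neg
    (ι := Unit) (h := fun _ t => K.lyapW (θ t))
    (h' := fun _ t => 1 / 2 * ∑ i, ∑ j, K.D i * K.D j *
      ((θ t i - θ t j) * (K.field (θ t) i - K.field (θ t) j))) (c := fun _ => c) (T := T)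
    (fun _ t ht => K.hasDerivWithinAt_lyapW (hθ t ht))
    (fun t ht _ _ hface => by
      have hfc : K.lyapW (θ t) = c := hface
      obtain ⟨hPρ, hmem⟩ := hgeom (θ t) hfc.le
      -- on the level surface `‖Hθ‖₂ ≥ μ`
      have hub := (K.lyapW_bounds hm hM (θ t)).2
      have hPμ : μ ^ 2 ≤ pairNormSq (θ t) := by
        by_contra hlt
        push Not at hlt
        have : M * pairNormSq (θ t) < M * μ ^ 2 := mul_lt_mul_of_pos_left hlt hM0
        linarith
      have hsqrt : μ ≤ Real.sqrt (pairNormSq (θ t)) := by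
        rw [← Real.sqrt_sq hμ.le]
        exact Real.sqrt_le_sqrt hPμ
      have hest := K.lyapW_deriv_le hD hP hφ0 hφ hsymm hρ0 hρπ hM hM0.le hMH0 hMH hlam hmem
      -- scalar step with `s = ‖Hθ‖₂ ≥ μ`: `M M_H s − B s² ≤ μ (M M_H − B μ) < 0`
      have hss : Real.sqrt (pairNormSq (θ t)) * Real.sqrt (pairNormSq (θ t)) = pairNormSq (θ t) :=
        Real.mul_self_sqrt (le_trans (sq_nonneg μ) hPμ)
      have hsc := face_scalar (A := M * MH) hB0 hμ hsqrt (by linarith)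
      rw [hss] at hsc
      have hneg : μ * (M * MH - K.kappa * (Real.sin ρ / ρ) * (lam / ↑n) * μ) < 0 :=
        mul_neg_of_pos_of_neg hμ (by linarith)
      show 1 / 2 * ∑ i, ∑ j, K.D i * K.D j *
        ((θ t i - θ t j) * (K.field (θ t) i - K.field (θ t) j)) < 0
      linarith)
    (fun _ => h0)
  intro t ht
  have hct : K.lyapW (θ t) ≤ c := key t ht ()
  exact ⟨hct, hgeom _ hct⟩

/-- **Synchronization condition II — ultimate boundedness** («ultimate boundedness arguments [HKK:02]
imply that, for every `‖Hθ(0)‖₂ ≤ αρ`, there is `T ≥ 0` such that `‖Hθ(t)‖₂ ≤ μ/α` for all `t ≥ T`»),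
quantitative certificate form. Under the hypotheses of `lyapW_sublevel_invariant` (and `M ≥ 0`,
automatic as soon as two oscillators exist), with the rate `η := μ·(κ (sin ρ/ρ)(λ/n) μ − M·M_H) > 0`: along every solution from `{𝒲 ≤ c}` on a window `[0, T]`
with `T ≤ 2(c − ½Mμ²)/η`, `𝒲(θ(t)) ≤ c − (η/2)·t`; so at `T* = 2(c − ½Mμ²)/η` the solution is in the
ultimate set `{𝒲 ≤ ½Mμ²} ⊆ {m‖Hθ‖₂² ≤ Mμ²}` (= `‖Hθ‖₂ ≤ μ/α`), which is itself positively invariant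
by `lyapW_sublevel_invariant` (with `c = ½Mμ²`). Proof: the moving barrier `𝒲(θ(t)) + (η/2)t ≤ c`
(on its face `𝒲 ≥ ½Mμ²`, hence `‖Hθ‖₂ ≥ μ` and `𝒲̇ ≤ −η`). [cite: DorflerBullo2012, arXiv:0910.5673
§5.2 Thm 5.5 statement 1) and its proof (ultimate boundedness paragraph: «for all `‖Hθ‖₂ ∈ [ρ, μ]`
(sic) … `𝒲(Hθ(t))` is strictly decreasing»)] -/
theorem lyapW_ultimate_bound (hD : ∀ i, 0 < K.D i) (hP : ∀ i j, 0 ≤ K.P i j)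
    (hφ0 : ∀ i j, 0 ≤ K.φ i j) (hφ : ∀ i j, K.φ i j ≤ Real.pi / 2)
    (hsymm : ∀ i j, K.P i j * Real.cos (K.φ i j) = K.P j i * Real.cos (K.φ j i))
    {ρ μ m M MH lam c T : ℝ} (hρ0 : 0 < ρ) (hρπ : ρ ≤ Real.pi) (hμ : 0 < μ)
    (hm0 : 0 < m) (hm : ∀ i j, i ≠ j → m ≤ K.D i * K.D j) (hM : ∀ i j, i ≠ j → K.D i * K.D j ≤ M)
    (hMnn : 0 ≤ M) (hc1 : M * μ ^ 2 ≤ 2 * c) (hc2 : 2 * c ≤ m * ρ ^ 2) (hMH0 : 0 ≤ MH)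
    (hMH : 1 / 2 * ∑ i, ∑ j,
      (|K.ω i / K.D i - K.ω j / K.D j| + ∑ k, K.b i k + ∑ k, K.b j k) ^ 2 ≤ MH ^ 2)
    (hlam0 : 0 ≤ lam)
    (hlam : ∀ v : Fin n → ℝ, lam * pairNormSq v
      ≤ n * (1 / 2 * ∑ i, ∑ j, K.P i j * Real.cos (K.φ i j) * (v i - v j) ^ 2))
    (hkey : M * MH < K.kappa * (Real.sin ρ / ρ) * (lam / n) * μ)
    {θ : ℝ → Fin n → ℝ} (hθ : ∀ t ∈ Icc 0 T, HasDerivWithinAt θ (K.field (θ t)) (Icc 0 T) t)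
    (h0 : K.lyapW (θ 0) ≤ c)
    (hT : T ≤ 2 * (c - 1 / 2 * M * μ ^ 2) /
      (μ * (K.kappa * (Real.sin ρ / ρ) * (lam / n) * μ - M * MH))) :
    ∀ t ∈ Icc 0 T, K.lyapW (θ t)
      ≤ c - μ * (K.kappa * (Real.sin ρ / ρ) * (lam / n) * μ - M * MH) / 2 * t := by
  have hη0 : 0 < μ * (K.kappa * (Real.sin ρ / ρ) * (lam / n) * μ - M * MH) :=
    mul_pos hμ (by linarith)
  -- time bookkeeping: on the window, `(η/2) t ≤ c − ½ M μ²`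
  have hwin : ∀ t ∈ Icc 0 T,
      μ * (K.kappa * (Real.sin ρ / ρ) * (lam / n) * μ - M * MH) / 2 * t
        ≤ c - 1 / 2 * M * μ ^ 2 := by
    intro t ht
    have ht2 : t ≤ 2 * (c - 1 / 2 * M * μ ^ 2) /
        (μ * (K.kappa * (Real.sin ρ / ρ) * (lam / n) * μ - M * MH)) := ht.2.trans hT
    rw [le_div_iff₀ hη0] at ht2
    nlinarith [ht2, ht.1]
  -- the invariant part: the solution stays in `{𝒲 ≤ c} ⊆ Δ̄(ρ)`
  have hinv := K.lyapW_sublevel_invariant hD hP hφ0 hφ hsymm hρ0 hρπ hμ hm0 hm hM hc1 hc2 hMH0 hMH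
    hlam0 hlam hkey hθ h0
  by_cases hpair : ∃ i j : Fin n, i ≠ j
  swap
  · -- no distinct pair: `𝒲 ≡ 0`, and `0 ≤ c − (η/2)t` from the window and `M ≥ 0`
    push Not at hpair
    have hW0 : ∀ ψ : Fin n → ℝ, K.lyapW ψ = 0 := fun ψ => by
      unfold lyapW
      rw [Finset.sum_eq_zero fun i _ => Finset.sum_eq_zero fun j _ => by
        rw [hpair i j, sub_self]; ring]
      ring
    intro t ht
    rw [hW0]
    have hc0 : 0 ≤ c := by rw [hW0] at h0; exact h0
    have h1 := hwin t ht
    nlinarith [sq_nonneg μ, hMnn, h1, hc0]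
  obtain ⟨i₀, j₀, hij₀⟩ := hpair
  have hM0 : 0 < M := lt_of_lt_of_le (mul_pos (hD i₀) (hD j₀)) (hM i₀ j₀ hij₀)
  have hB0 : 0 ≤ K.kappa * (Real.sin ρ / ρ) * (lam / n) := by
    have hκ0 : 0 ≤ K.kappa := Finset.sum_nonneg fun k _ => (hD k).le
    have hsinc0 : 0 ≤ Real.sin ρ / ρ :=
      div_nonneg (Real.sin_nonneg_of_nonneg_of_le_pi hρ0.le hρπ) hρ0.le
    have : 0 ≤ lam / n := div_nonneg hlam0 (Nat.cast_nonneg n)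
    positivity
  -- the moving barrier `𝒲(θ(t)) + (η/2) t ≤ c`
  have key := Literature.Analysis.ODE.forall_le_of_hasDerivWithinAt_of_eq_imp_deriv_neg
    (ι := Unit)
    (h := fun _ t => K.lyapW (θ t)
      + μ * (K.kappa * (Real.sin ρ / ρ) * (lam / n) * μ - M * MH) / 2 * t)
    (h' := fun _ t => 1 / 2 * ∑ i, ∑ j, K.D i * K.D j *
      ((θ t i - θ t j) * (K.field (θ t) i - K.field (θ t) j))
      + μ * (K.kappa * (Real.sin ρ / ρ) * (lam / n) * μ - M * MH) / 2 * 1)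
    (c := fun _ => c) (T := T)
    (fun _ t ht => (K.hasDerivWithinAt_lyapW (hθ t ht)).add
      ((hasDerivWithinAt_id t (Icc 0 T)).const_mul _))
    (fun t ht _ _ hface => by
      have hfc : K.lyapW (θ t)
          + μ * (K.kappa * (Real.sin ρ / ρ) * (lam / n) * μ - M * MH) / 2 * t = c := hface
      -- the current level is at least `½ M μ²`, so `‖Hθ‖₂ ≥ μ`
      have hlev : 1 / 2 * M * μ ^ 2 ≤ K.lyapW (θ t) := by linarith [hwin t ht]
      obtain ⟨_, _, hmem⟩ := hinv t ht
      have hub := (K.lyapW_bounds hm hM (θ t)).2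
      have hPμ : μ ^ 2 ≤ pairNormSq (θ t) := by
        by_contra hlt
        push Not at hlt
        have : M * pairNormSq (θ t) < M * μ ^ 2 := mul_lt_mul_of_pos_left hlt hM0
        linarith
      have hsqrt : μ ≤ Real.sqrt (pairNormSq (θ t)) := by
        rw [← Real.sqrt_sq hμ.le]
        exact Real.sqrt_le_sqrt hPμ
      have hest := K.lyapW_deriv_le hD hP hφ0 hφ hsymm hρ0 hρπ hM hM0.le hMH0 hMH hlam hmem
      -- scalar step with `s = ‖Hθ‖₂ ≥ μ`: `𝒲̇ ≤ M M_H s − B s² ≤ μ (M M_H − B μ) = −η`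
      have hss : Real.sqrt (pairNormSq (θ t)) * Real.sqrt (pairNormSq (θ t)) = pairNormSq (θ t) :=
        Real.mul_self_sqrt (le_trans (sq_nonneg μ) hPμ)
      have hsc := face_scalar (A := M * MH) hB0 hμ hsqrt (by linarith)
      rw [hss] at hsc
      show 1 / 2 * ∑ i, ∑ j, K.D i * K.D j *
          ((θ t i - θ t j) * (K.field (θ t) i - K.field (θ t) j))
        + μ * (K.kappa * (Real.sin ρ / ρ) * (lam / n) * μ - M * MH) / 2 * 1 < 0
      linarith)
    (fun _ => by
      show K.lyapW (θ 0) + μ * (K.kappa * (Real.sin ρ / ρ) * (lam / n) * μ - M * MH) / 2 * 0 ≤ c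
      linarith)
  intro t ht
  have h' : K.lyapW (θ t)
      + μ * (K.kappa * (Real.sin ρ / ρ) * (lam / n) * μ - M * MH) / 2 * t ≤ c := key t ht ()
  linarith

/-- **Thm 5.5 1) in the printed two-norm shape** (`α² = m/M`). If `M‖Hθ(0)‖₂² ≤ mρ²`
(«`‖Hθ(0)‖₂ ≤ αρ`») and `Mμ² ≤ mρ²` («`μ < αρ`», eq. (Squeezing level sets into an interval); equality
allowed here because the key inequality is strict), then (i) `‖Hθ(t)‖₂ ≤ ρ` and `θ(t) ∈ Δ̄(ρ)` for all
`t ∈ [0, T]` (phase cohesiveness), and (ii) on any window `T ≤ T⋆ := (mρ² − Mμ²)/η`,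
`η = μ(κ(sin ρ/ρ)(λ/n)μ − M·M_H)`: `m‖Hθ(t)‖₂² ≤ mρ² − η·t` («`‖Hθ(t)‖₂` is strictly decreasing for
`t ∈ [0, T]`»), so that `m‖Hθ(T⋆)‖₂² ≤ Mμ²`, i.e. `‖Hθ(T⋆)‖₂ ≤ μ/α`; the terminal set is kept by
`terminal_sublevel_invariant`. [cite: DorflerBullo2012, arXiv:0910.5673 §5.2 Thm 5.5 statement 1)
(«phase cohesiveness: … positively invariant … and each trajectory … reaches …») and proof («for every
`‖Hθ(0)‖₂ ≤ αρ`, there is `T ≥ 0` such that … `‖Hθ(t)‖₂ ≤ μ/α` for all `t ≥ T`»)] -/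
theorem two_norm_cohesive (hD : ∀ i, 0 < K.D i) (hP : ∀ i j, 0 ≤ K.P i j)
    (hφ0 : ∀ i j, 0 ≤ K.φ i j) (hφ : ∀ i j, K.φ i j ≤ Real.pi / 2)
    (hsymm : ∀ i j, K.P i j * Real.cos (K.φ i j) = K.P j i * Real.cos (K.φ j i))
    {ρ μ m M MH lam T : ℝ} (hρ0 : 0 < ρ) (hρπ : ρ ≤ Real.pi) (hμ : 0 < μ)
    (hm0 : 0 < m) (hm : ∀ i j, i ≠ j → m ≤ K.D i * K.D j) (hM : ∀ i j, i ≠ j → K.D i * K.D j ≤ M)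
    (hMnn : 0 ≤ M) (hsq : M * μ ^ 2 ≤ m * ρ ^ 2) (hMH0 : 0 ≤ MH)
    (hMH : 1 / 2 * ∑ i, ∑ j,
      (|K.ω i / K.D i - K.ω j / K.D j| + ∑ k, K.b i k + ∑ k, K.b j k) ^ 2 ≤ MH ^ 2)
    (hlam0 : 0 ≤ lam)
    (hlam : ∀ v : Fin n → ℝ, lam * pairNormSq v
      ≤ n * (1 / 2 * ∑ i, ∑ j, K.P i j * Real.cos (K.φ i j) * (v i - v j) ^ 2))
    (hkey : M * MH < K.kappa * (Real.sin ρ / ρ) * (lam / n) * μ)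
    {θ : ℝ → Fin n → ℝ} (hθ : ∀ t ∈ Icc 0 T, HasDerivWithinAt θ (K.field (θ t)) (Icc 0 T) t)
    (h0 : M * pairNormSq (θ 0) ≤ m * ρ ^ 2) :
    (∀ t ∈ Icc 0 T, pairNormSq (θ t) ≤ ρ ^ 2 ∧ θ t ∈ arcPolytope n ρ) ∧
    (T ≤ (m * ρ ^ 2 - M * μ ^ 2) / (μ * (K.kappa * (Real.sin ρ / ρ) * (lam / n) * μ - M * MH)) →
      ∀ t ∈ Icc 0 T, m * pairNormSq (θ t)
        ≤ m * ρ ^ 2 - μ * (K.kappa * (Real.sin ρ / ρ) * (lam / n) * μ - M * MH) * t) := by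
  have hc1 : M * μ ^ 2 ≤ 2 * (1 / 2 * m * ρ ^ 2) := by linarith
  have hc2 : 2 * (1 / 2 * m * ρ ^ 2) ≤ m * ρ ^ 2 := by linarith
  have hW0 : K.lyapW (θ 0) ≤ 1 / 2 * m * ρ ^ 2 := by
    have := (K.lyapW_bounds hm hM (θ 0)).2
    linarith
  refine ⟨fun t ht => (K.lyapW_sublevel_invariant hD hP hφ0 hφ hsymm hρ0 hρπ hμ hm0 hm hM hc1 hc2
    hMH0 hMH hlam0 hlam hkey hθ hW0 t ht).2, fun hT t ht => ?_⟩
  have hT' : T ≤ 2 * (1 / 2 * m * ρ ^ 2 - 1 / 2 * M * μ ^ 2) /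
      (μ * (K.kappa * (Real.sin ρ / ρ) * (lam / n) * μ - M * MH)) := by
    have : 2 * (1 / 2 * m * ρ ^ 2 - 1 / 2 * M * μ ^ 2) = m * ρ ^ 2 - M * μ ^ 2 := by ring
    rw [this]
    exact hT
  have h1 := K.lyapW_ultimate_bound hD hP hφ0 hφ hsymm hρ0 hρπ hμ hm0 hm hM hMnn hc1 hc2 hMH0 hMH
    hlam0 hlam hkey hθ hW0 hT' t ht
  have h2 := (K.lyapW_bounds hm hM (θ t)).1
  linarith

/-- **The terminal set is kept.** Under the same static hypotheses, the ultimate set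
`{𝒲 ≤ ½Mμ²}` (reached at `T⋆` by `two_norm_cohesive`/`lyapW_ultimate_bound`) is positively invariant
and lies in `{m‖Hθ‖₂² ≤ Mμ²}` = «`‖Hθ‖₂ ≤ μ/α`» — the «for all `t ≥ T`» clause of the printed ultimate
bound, in the tree's finite-window convention (restart the clock at `T⋆`).
[cite: DorflerBullo2012, arXiv:0910.5673 §5.2 proof of Thm 5.5 («`‖Hθ(t)‖₂ ≤ μ/α` for all
`t ≥ T`»)] -/
theorem terminal_sublevel_invariant (hD : ∀ i, 0 < K.D i) (hP : ∀ i j, 0 ≤ K.P i j)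
    (hφ0 : ∀ i j, 0 ≤ K.φ i j) (hφ : ∀ i j, K.φ i j ≤ Real.pi / 2)
    (hsymm : ∀ i j, K.P i j * Real.cos (K.φ i j) = K.P j i * Real.cos (K.φ j i))
    {ρ μ m M MH lam T : ℝ} (hρ0 : 0 < ρ) (hρπ : ρ ≤ Real.pi) (hμ : 0 < μ)
    (hm0 : 0 < m) (hm : ∀ i j, i ≠ j → m ≤ K.D i * K.D j) (hM : ∀ i j, i ≠ j → K.D i * K.D j ≤ M)
    (hsq : M * μ ^ 2 ≤ m * ρ ^ 2) (hMH0 : 0 ≤ MH)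
    (hMH : 1 / 2 * ∑ i, ∑ j,
      (|K.ω i / K.D i - K.ω j / K.D j| + ∑ k, K.b i k + ∑ k, K.b j k) ^ 2 ≤ MH ^ 2)
    (hlam0 : 0 ≤ lam)
    (hlam : ∀ v : Fin n → ℝ, lam * pairNormSq v
      ≤ n * (1 / 2 * ∑ i, ∑ j, K.P i j * Real.cos (K.φ i j) * (v i - v j) ^ 2))
    (hkey : M * MH < K.kappa * (Real.sin ρ / ρ) * (lam / n) * μ)
    {θ : ℝ → Fin n → ℝ} (hθ : ∀ t ∈ Icc 0 T, HasDerivWithinAt θ (K.field (θ t)) (Icc 0 T) t)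
    (h0 : K.lyapW (θ 0) ≤ 1 / 2 * M * μ ^ 2) :
    ∀ t ∈ Icc 0 T, K.lyapW (θ t) ≤ 1 / 2 * M * μ ^ 2 ∧ m * pairNormSq (θ t) ≤ M * μ ^ 2 := by
  intro t ht
  have hc1 : M * μ ^ 2 ≤ 2 * (1 / 2 * M * μ ^ 2) := by linarith
  have hc2 : 2 * (1 / 2 * M * μ ^ 2) ≤ m * ρ ^ 2 := by linarith
  have h1 := (K.lyapW_sublevel_invariant hD hP hφ0 hφ hsymm hρ0 hρπ hμ hm0 hm hM hc1 hc2 hMH0 hMH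
    hlam0 hlam hkey hθ h0 t ht).1
  have h2 := (K.lyapW_bounds hm hM (θ t)).1
  exact ⟨h1, by linarith⟩

end NonuniformKuramoto

/-! ### Bridge: sparse lossless droop-controlled inverter networks (SPDB2013 Lemma 1) -/

namespace DroopNetwork

variable (N : DroopNetwork n)

/-- **Phase cohesiveness of a lossless droop-controlled all-inverter network on a CONNECTED (possibly
sparse) graph** — Dörfler–Bullo synchronization condition II with `φ = 0`, read through SPDB2013
Lemma 1 (`ω = P*`, `Pᵢⱼ = aᵢⱼ = EᵢEⱼ|Yᵢⱼ|` symmetric and `≥ 0`). Certificate shape: pair-product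
bounds `0 < m ≤ DᵢDⱼ ≤ M`, the data bound `½ΣΣ|Pᵢ*/Dᵢ − Pⱼ*/Dⱼ|² ≤ M_H²` (no lossy term), a
connectivity certificate `λ‖Hv‖₂² ≤ n·½ΣΣaᵢⱼ(vᵢ−vⱼ)²` (`λ ≤ λ₂(L(a))`, an `n × n` PSD check), radii
`0 < μ`, `0 < ρ ≤ π` with `Mμ² ≤ mρ²`, and the strict key inequality `M·M_H < (ΣDₖ)(sin ρ/ρ)(λ/n)μ`.
Conclusion as in `NonuniformKuramoto.two_norm_cohesive`: from `M‖Hθ(0)‖₂² ≤ mρ²`, `θ(t) ∈ Δ̄(ρ)` for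
all `t ∈ [0, T]`, and `m‖Hθ(t)‖₂² ≤ mρ² − η t` on windows `T ≤ (mρ² − Mμ²)/η`. MODELLED: lossless
lines, constant amplitudes, no load buses. [cite: DorflerBullo2012, arXiv:0910.5673 §5.2 Thm 5.5
statement 1); SimpsonporcoDorflerBullo2013, §3 Lemma 1] -/
theorem two_norm_cohesive (hD : ∀ i, 0 < N.Dc i) (ha : ∀ i j, 0 ≤ N.a i j)
    (hasymm : ∀ i j, N.a i j = N.a j i)
    {ρ μ m M MH lam T : ℝ} (hρ0 : 0 < ρ) (hρπ : ρ ≤ Real.pi) (hμ : 0 < μ)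
    (hm0 : 0 < m) (hm : ∀ i j, i ≠ j → m ≤ N.Dc i * N.Dc j)
    (hM : ∀ i j, i ≠ j → N.Dc i * N.Dc j ≤ M) (hMnn : 0 ≤ M) (hsq : M * μ ^ 2 ≤ m * ρ ^ 2)
    (hMH0 : 0 ≤ MH)
    (hMH : 1 / 2 * ∑ i, ∑ j, |N.Pstar i / N.Dc i - N.Pstar j / N.Dc j| ^ 2 ≤ MH ^ 2)
    (hlam0 : 0 ≤ lam)
    (hlam : ∀ v : Fin n → ℝ, lam * pairNormSq v
      ≤ n * (1 / 2 * ∑ i, ∑ j, N.a i j * (v i - v j) ^ 2))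
    (hkey : M * MH < (∑ k, N.Dc k) * (Real.sin ρ / ρ) * (lam / n) * μ)
    {θ : ℝ → Fin n → ℝ} (hsol : ∀ t ∈ Icc 0 T, N.IsSolutionAt θ t)
    (h0 : M * pairNormSq (θ 0) ≤ m * ρ ^ 2) :
    (∀ t ∈ Icc 0 T, pairNormSq (θ t) ≤ ρ ^ 2 ∧ θ t ∈ arcPolytope n ρ) ∧
    (T ≤ (m * ρ ^ 2 - M * μ ^ 2) / (μ * ((∑ k, N.Dc k) * (Real.sin ρ / ρ) * (lam / n) * μ - M * MH)) →
      ∀ t ∈ Icc 0 T, m * pairNormSq (θ t)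
        ≤ m * ρ ^ 2 - μ * ((∑ k, N.Dc k) * (Real.sin ρ / ρ) * (lam / n) * μ - M * MH) * t) := by
  have hb : ∀ i k, N.toKuramoto.b i k = 0 := fun i k => by
    simp [NonuniformKuramoto.b, toKuramoto]
  have hcos : ∀ i j, N.toKuramoto.P i j * Real.cos (N.toKuramoto.φ i j) = N.a i j := fun i j => by
    simp [toKuramoto]
  have hMH' : 1 / 2 * ∑ i, ∑ j, (|N.toKuramoto.ω i / N.toKuramoto.D i
      - N.toKuramoto.ω j / N.toKuramoto.D j| + ∑ k, N.toKuramoto.b i k + ∑ k, N.toKuramoto.b j k) ^ 2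
        ≤ MH ^ 2 := by
    simp only [hb, Finset.sum_const_zero, add_zero]
    exact hMH
  have hlam' : ∀ v : Fin n → ℝ, lam * pairNormSq v ≤ n * (1 / 2 * ∑ i, ∑ j,
      N.toKuramoto.P i j * Real.cos (N.toKuramoto.φ i j) * (v i - v j) ^ 2) := by
    simp only [hcos]
    exact hlam
  have hkappa : N.toKuramoto.kappa = ∑ k, N.Dc k := by simp [NonuniformKuramoto.kappa, toKuramoto]
  have h := N.toKuramoto.two_norm_cohesive (m := m) (M := M) (MH := MH) (lam := lam) (T := T) hD ha
    (fun _ _ => le_rfl) (fun _ _ => by simp [toKuramoto]; positivity)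
    (fun i j => by rw [hcos, hcos, hasymm]) hρ0 hρπ hμ hm0 hm hM hMnn hsq hMH0 hMH' hlam0 hlam'
    (by rw [hkappa]; exact hkey) (fun t ht => N.hasDerivWithinAt_of_isSolutionAt hD (hsol t ht)) h0
  rw [hkappa] at h
  exact h

end DroopNetwork

/-! ### Appendix (gridfusion-lit-1 g5, append 1): Theorem 5.1 statement 2) — exponential frequency
synchronization to `Ω = Σωᵢ/ΣDᵢ` at the rate `λ_fe` on CONNECTED (sparse) graphs, certificate form

[DorflerBullo2012, arXiv:0910.5673 §5.1 Thm 5.1 (Frequency synchronization) statement 2) and its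
proof («In the case of zero shifts and symmetric coupling …»)]: for `φ = 0`, `P = Pᵀ`, along a
trajectory staying in `Δ̄(γ)`, `γ ∈ [0, π/2]`, the weighted disagreement `δ = θ̇ − Ω𝟙` obeys
`Σᵢ Dᵢδᵢ = 0` (conserved quantity `Σ Dᵢθ̇ᵢ = Σ ωᵢ`) and `d/dt δᵀDδ = −2δᵀL(w(t))δ ≤ −2λ_fe δᵀDδ`
with `λ_fe = λ₂(L(Pᵢⱼ)) cos γ cos²(∠(D𝟙, 𝟙))/D_max` (the printed display carries a stray minus sign;
the proof's `e^{−2λ_fe t}` fixes the convention).  As in the rest of this file `λ₂` enters through the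
PSD certificate `λ‖Hv‖₂² ≤ n·½ΣΣPᵢⱼ(vᵢ−vⱼ)²`, and `cos²(∠(D𝟙,𝟙)) = (ΣDᵢ)²/(n ΣDᵢ²)` is kept as the
rational it is. -/

/-- `‖Hv‖₂² = n Σᵢvᵢ² − (Σᵢvᵢ)²` (the complete-graph Laplacian identity `HᵀH = nI − 𝟙𝟙ᵀ`).
[cite: DorflerBullo2012, arXiv:0910.5673 §5.1 proof of Thm 5.1 (decomposition
`δ = (𝟙ᵀδ/n)𝟙 + δ_⊥`, `‖Hδ‖² = n‖δ_⊥‖²`)] -/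
theorem pairNormSq_eq (v : Fin n → ℝ) :
    pairNormSq v = n * ∑ i, v i ^ 2 - (∑ i, v i) ^ 2 := by
  unfold pairNormSq
  have h1 : ∑ i, ∑ j, (v i - v j) ^ 2 = ∑ i, ∑ j, (v i ^ 2 + v j ^ 2 - 2 * (v i * v j)) :=
    Finset.sum_congr rfl fun i _ => Finset.sum_congr rfl fun j _ => by ring
  have h2 : ∑ i, ∑ j, (v i ^ 2 + v j ^ 2 - 2 * (v i * v j))
      = ∑ i : Fin n, ∑ _j : Fin n, v i ^ 2 + ∑ _i : Fin n, ∑ j : Fin n, v j ^ 2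
        - 2 * ∑ i, ∑ j, v i * v j := by
    simp only [Finset.sum_sub_distrib, Finset.sum_add_distrib, Finset.mul_sum]
  have h3 : ∑ i : Fin n, ∑ _j : Fin n, v i ^ 2 = n * ∑ i, v i ^ 2 := by
    simp [Finset.sum_const, Finset.card_univ, Fintype.card_fin, Finset.mul_sum]
  have h4 : ∑ _i : Fin n, ∑ j : Fin n, v j ^ 2 = n * ∑ i, v i ^ 2 := by
    simp [Finset.sum_const, Finset.card_univ, Fintype.card_fin]
  have h5 : ∑ i, ∑ j, v i * v j = (∑ i, v i) ^ 2 := by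
    rw [sq, Finset.sum_mul_sum]
  rw [h1, h2, h3, h4, h5]
  ring

/-- **The dihedral-angle bound** `‖δ_⊥‖² ≥ cos²(∠(D𝟙, 𝟙))‖δ‖²` on the weighted disagreement space
`Σ Dᵢδᵢ = 0`, in rational form: `(ΣDᵢ²)·‖Hδ‖₂² ≥ (ΣDᵢ)²·Σδᵢ²` — Cauchy–Schwarz with the vector
`(ΣDₖ²) − (ΣDₖ)Dᵢ`. [cite: DorflerBullo2012, arXiv:0910.5673 §5.1 proof of Thm 5.1 («we obtain the
dihedral angle as the angle between the normal vectors `D𝟙` and `𝟙` … `‖δ‖ ≥ ‖δ_⊥‖ ≥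
‖δ‖cos(∠(D𝟙,𝟙))`»)] -/
theorem disagreement_pairNormSq_ge (D δ : Fin n → ℝ) (hDδ : ∑ i, D i * δ i = 0) :
    (∑ i, D i) ^ 2 * ∑ i, δ i ^ 2 ≤ (∑ i, D i ^ 2) * pairNormSq δ := by
  set S1 := ∑ i, D i with hS1
  set S2 := ∑ i, D i ^ 2 with hS2
  -- Cauchy–Schwarz for `aᵢ = S2 − S1 Dᵢ` and `δ`
  have hCS := Finset.sum_mul_sq_le_sq_mul_sq Finset.univ (fun i => S2 - S1 * D i) δ
  have ha : ∑ i, (S2 - S1 * D i) * δ i = S2 * ∑ i, δ i := by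
    have : ∑ i, (S2 - S1 * D i) * δ i = S2 * ∑ i, δ i - S1 * ∑ i, D i * δ i := by
      rw [Finset.mul_sum, Finset.mul_sum, ← Finset.sum_sub_distrib]
      exact Finset.sum_congr rfl fun i _ => by ring
    rw [this, hDδ]; ring
  have hb : ∑ i, (S2 - S1 * D i) ^ 2 = S2 * (n * S2 - S1 ^ 2) := by
    have : ∑ i, (S2 - S1 * D i) ^ 2 = ∑ i, (S2 ^ 2 - 2 * S2 * S1 * D i + S1 ^ 2 * D i ^ 2) :=
      Finset.sum_congr rfl fun i _ => by ring
    rw [this, Finset.sum_add_distrib, Finset.sum_sub_distrib, Finset.sum_const, Finset.card_univ,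
      Fintype.card_fin, ← Finset.mul_sum, ← Finset.mul_sum, ← hS1, ← hS2]
    simp only [nsmul_eq_mul]
    ring
  rw [ha, hb] at hCS
  -- `S2² (Σδ)² ≤ S2 (n S2 − S1²) Σδ²`; combine with `‖Hδ‖² = nΣδ² − (Σδ)²`
  rw [pairNormSq_eq]
  rcases (Finset.sum_nonneg fun i (_ : i ∈ Finset.univ) => sq_nonneg (D i)).eq_or_lt with h0 | hpos
  · -- `S2 = 0`: all `Dᵢ = 0`, so `S1 = 0`
    have hS20 : S2 = 0 := by rw [hS2]; exact h0.symm
    have hDi : ∀ i, D i = 0 := fun i => by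
      have := (Finset.sum_eq_zero_iff_of_nonneg fun j (_ : j ∈ Finset.univ) => sq_nonneg (D j)).1
        h0.symm i (Finset.mem_univ i)
      exact pow_eq_zero_iff (n := 2) (by norm_num) |>.1 this
    have hS10 : S1 = 0 := by rw [hS1]; exact Finset.sum_eq_zero fun i _ => hDi i
    rw [hS10, hS20]; simp
  · have hS2pos : 0 < S2 := by rw [hS2]; exact hpos
    have hδ2 : 0 ≤ ∑ i, δ i ^ 2 := Finset.sum_nonneg fun i _ => sq_nonneg _
    -- divide the Cauchy–Schwarz inequality by `S2 > 0`
    have h1 : S2 * (∑ i, δ i) ^ 2 ≤ (n * S2 - S1 ^ 2) * ∑ i, δ i ^ 2 := by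
      have h' : S2 * (S2 * (∑ i, δ i) ^ 2) ≤ S2 * ((n * S2 - S1 ^ 2) * ∑ i, δ i ^ 2) := by
        nlinarith [hCS]
      exact le_of_mul_le_mul_left h' hS2pos
    nlinarith [h1]

/-- Symmetrisation for a symmetric kernel and a square: `ΣᵢΣⱼ cᵢⱼ(vᵢ−vⱼ)² = 2Σᵢ vᵢ Σⱼ cᵢⱼ(vᵢ−vⱼ)`.
[cite: DorflerBullo2012, arXiv:0910.5673 §5.1 proof of Thm 5.1 («`d/dt δᵀDδ = −2δᵀL(wᵢⱼ(t))δ`»,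
with `δᵀLδ = ½ΣΣwᵢⱼ(δᵢ−δⱼ)²`)] -/
theorem sum_sum_mul_sub_sq (c : Fin n → Fin n → ℝ) (hc : ∀ i j, c i j = c j i) (v : Fin n → ℝ) :
    ∑ i, ∑ j, c i j * (v i - v j) ^ 2 = 2 * ∑ i, v i * ∑ j, c i j * (v i - v j) := by
  have hsplit : ∑ i, ∑ j, c i j * (v i - v j) ^ 2
      = ∑ i, ∑ j, c i j * (v i - v j) * v i - ∑ i, ∑ j, c i j * (v i - v j) * v j := by
    rw [← Finset.sum_sub_distrib]
    refine Finset.sum_congr rfl fun i _ => ?_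
    rw [← Finset.sum_sub_distrib]
    exact Finset.sum_congr rfl fun j _ => by ring
  have hswap : ∑ i, ∑ j, c i j * (v i - v j) * v j = -∑ i, ∑ j, c i j * (v i - v j) * v i := by
    rw [Finset.sum_comm, ← Finset.sum_neg_distrib]
    refine Finset.sum_congr rfl fun i _ => ?_
    rw [← Finset.sum_neg_distrib]
    exact Finset.sum_congr rfl fun j _ => by rw [hc j i]; ring
  have hfac : ∑ i, ∑ j, c i j * (v i - v j) * v i = ∑ i, v i * ∑ j, c i j * (v i - v j) := by
    refine Finset.sum_congr rfl fun i _ => ?_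
    rw [Finset.mul_sum]
    exact Finset.sum_congr rfl fun j _ => by ring
  rw [hsplit, hswap, hfac]
  ring

namespace NonuniformKuramoto

variable (K : NonuniformKuramoto n)

/-- The synchronization frequency `Ω := Σᵢ ωᵢ / Σᵢ Dᵢ` of the lossless symmetric model.
[cite: DorflerBullo2012, arXiv:0910.5673 §5.1 Thm 5.1 statement 2)] -/
def syncFreq : ℝ := (∑ i, K.ω i) / K.kappa

/-- **Conserved quantity** («`Σᵢ Dᵢθ̇ᵢ(t)` is a constant conserved quantity»): for zero phase shifts and
symmetric coupling, `Σᵢ Dᵢ θ̇ᵢ = Σᵢ ωᵢ` identically on the state space (`Dᵢ ≠ 0`).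
[cite: DorflerBullo2012, arXiv:0910.5673 §5.1 proof of Thm 5.1 statement 2)] -/
theorem sum_D_mul_field (hD : ∀ i, K.D i ≠ 0) (hφ : ∀ i j, K.φ i j = 0)
    (hsymm : ∀ i j, K.P i j = K.P j i) (θ : Fin n → ℝ) :
    ∑ i, K.D i * K.field θ i = ∑ i, K.ω i := by
  have h1 : ∀ i, K.D i * K.field θ i = K.ω i - ∑ j, K.P i j * Real.sin (θ i - θ j) := by
    intro i
    unfold field
    simp only [hφ, add_zero]
    field_simp [hD i]
  simp_rw [h1]
  rw [Finset.sum_sub_distrib]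
  have h0 : ∑ i, ∑ j, K.P i j * Real.sin (θ i - θ j) = 0 := by
    have h := sum_sum_sin_mul_sub K.P hsymm θ (fun _ => (1 : ℝ))
    simp only [sub_self, mul_zero, Finset.sum_const_zero] at h
    have h' := sum_sum_sin_mul_sub K.P hsymm θ θ
    -- direct antisymmetry argument
    have hanti : ∑ i, ∑ j, K.P i j * Real.sin (θ i - θ j)
        = -∑ i, ∑ j, K.P i j * Real.sin (θ i - θ j) := by
      conv_rhs => rw [Finset.sum_comm]
      rw [← Finset.sum_neg_distrib]
      refine Finset.sum_congr rfl fun i _ => ?_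
      rw [← Finset.sum_neg_distrib]
      refine Finset.sum_congr rfl fun j _ => ?_
      rw [hsymm j i, show θ j - θ i = -(θ i - θ j) by ring, Real.sin_neg]
      ring
    linarith
  rw [h0, sub_zero]

/-- The weighted disagreement sums to zero: `Σᵢ Dᵢ(θ̇ᵢ − Ω) = 0` (`Dᵢ > 0`).
[cite: DorflerBullo2012, arXiv:0910.5673 §5.1 proof of Thm 5.1 («`𝟙ᵀDδ = 0`»)] -/
theorem sum_D_mul_disagreement (hD : ∀ i, 0 < K.D i) (hφ : ∀ i j, K.φ i j = 0)
    (hsymm : ∀ i j, K.P i j = K.P j i) (θ : Fin n → ℝ) :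
    ∑ i, K.D i * (K.field θ i - K.syncFreq) = 0 := by
  have h := K.sum_D_mul_field (fun i => (hD i).ne') hφ hsymm θ
  simp only [mul_sub, Finset.sum_sub_distrib, h, ← Finset.sum_mul]
  unfold syncFreq kappa
  rcases Nat.eq_zero_or_pos n with hn | hn
  · subst hn; simp
  · have hκ : 0 < ∑ i, K.D i := by
      have : (Finset.univ : Finset (Fin n)).Nonempty := Finset.univ_nonempty_iff.2 ⟨⟨0, hn⟩⟩
      exact Finset.sum_pos (fun i _ => hD i) this
    field_simp
    ring

/-- **Theorem 5.1 statement 2), certificate form — exponential frequency synchronization to `Ω` at the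
rate `λ_fe`.**  Zero phase shifts, symmetric `Pᵢⱼ ≥ 0`, `Dᵢ > 0` with `Dᵢ ≤ D_max`, a connectivity
certificate `λ‖Hv‖₂² ≤ n·½ΣΣPᵢⱼ(vᵢ−vⱼ)²` (`λ ≥ 0`, `λ ≤ λ₂(L(P))`), and a solution on `[0, T]` staying
in `Δ̄(γ)`, `γ ∈ [0, π/2]` (e.g. by `two_norm_cohesive` or by condition I).  Then the weighted
disagreement function `E(t) = Σᵢ Dᵢ(θ̇ᵢ(t) − Ω)²` satisfies `E(t) ≤ E(0)·e^{−2λ_fe t}` with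
`λ_fe = λ cos γ (ΣDᵢ)² / (n (ΣDᵢ²) D_max)` (`= λ cos γ cos²(∠(D𝟙,𝟙))/D_max`).
[cite: DorflerBullo2012, arXiv:0910.5673 §5.1 Thm 5.1 statement 2), eq. (rate lambda_fe), and its
proof (weighted disagreement dynamics, Courant–Fischer, dihedral angle, Bellman–Gronwall)] -/
theorem disagreement_decay (hD : ∀ i, 0 < K.D i) (hP : ∀ i j, 0 ≤ K.P i j)
    (hφ : ∀ i j, K.φ i j = 0) (hsymm : ∀ i j, K.P i j = K.P j i)
    {γ lam Dmax T : ℝ} (hγ0 : 0 ≤ γ) (hγ : γ ≤ Real.pi / 2) (hlam0 : 0 ≤ lam)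
    (hlam : ∀ v : Fin n → ℝ, lam * pairNormSq v ≤ n * (1 / 2 * ∑ i, ∑ j, K.P i j * (v i - v j) ^ 2))
    (hDmax : ∀ i, K.D i ≤ Dmax)
    {θ : ℝ → Fin n → ℝ} (hθ : ∀ t ∈ Icc 0 T, HasDerivWithinAt θ (K.field (θ t)) (Icc 0 T) t)
    (hinv : ∀ t ∈ Icc 0 T, θ t ∈ arcPolytope n γ) :
    ∀ t ∈ Icc 0 T, ∑ i, K.D i * (K.field (θ t) i - K.syncFreq) ^ 2
      ≤ (∑ i, K.D i * (K.field (θ 0) i - K.syncFreq) ^ 2) *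
        Real.exp (-(2 * (lam * Real.cos γ * K.kappa ^ 2 / (n * (∑ i, K.D i ^ 2) * Dmax))) * t) := by
  -- names: disagreement δ(t), weights w(t), rate r
  obtain ⟨δ, hδ⟩ : ∃ δ : ℝ → Fin n → ℝ, ∀ s i, δ s i = K.field (θ s) i - K.syncFreq :=
    ⟨_, fun _ _ => rfl⟩
  obtain ⟨w, hw⟩ : ∃ w : ℝ → Fin n → Fin n → ℝ,
      ∀ s i j, w s i j = K.P i j * Real.cos (θ s i - θ s j) := ⟨_, fun _ _ _ => rfl⟩
  set r : ℝ := lam * Real.cos γ * K.kappa ^ 2 / (n * (∑ i, K.D i ^ 2) * Dmax) with hr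
  -- trivial case `n = 0`
  rcases Nat.eq_zero_or_pos n with hn | hn
  · subst hn
    intro t _
    simp
  have hne : (Finset.univ : Finset (Fin n)).Nonempty := Finset.univ_nonempty_iff.2 ⟨⟨0, hn⟩⟩
  have hS2 : 0 < ∑ i, K.D i ^ 2 := Finset.sum_pos (fun i _ => pow_pos (hD i) 2) hne
  have hDmax0 : 0 < Dmax := lt_of_lt_of_le (hD ⟨0, hn⟩) (hDmax ⟨0, hn⟩)
  have hκ : 0 < K.kappa := Finset.sum_pos (fun i _ => hD i) hne
  have hcos : 0 ≤ Real.cos γ := Real.cos_nonneg_of_neg_pi_div_two_le_of_le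
    (by linarith [Real.pi_pos]) hγ
  have hr0 : 0 ≤ r := by rw [hr]; positivity
  -- (1) derivative of E(t) = Σ Dᵢ δᵢ²
  have hEder : ∀ t ∈ Icc 0 T, HasDerivWithinAt (fun s => ∑ i, K.D i * δ s i ^ 2)
      (∑ i, K.D i * (2 * δ t i * (-∑ j, w t i j / K.D i * (δ t i - δ t j)))) (Icc 0 T) t := by
    intro t ht
    refine HasDerivWithinAt.fun_sum fun i _ => ?_
    have hf := K.hasDerivWithinAt_field (hθ t ht) i
    have hδd : HasDerivWithinAt (fun s => δ s i)
        (-∑ j, w t i j / K.D i * (δ t i - δ t j)) (Icc 0 T) t := by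
      have e1 : (fun s => δ s i) = fun s => K.field (θ s) i - K.syncFreq := funext fun s => hδ s i
      rw [e1]
      refine (hf.sub_const K.syncFreq).congr_deriv ?_
      congr 1
      refine Finset.sum_congr rfl fun j _ => ?_
      rw [hw, hφ, add_zero, hδ, hδ]
      ring
    have := (hδd.pow 2).const_mul (K.D i)
    refine this.congr_deriv ?_
    simp
  -- (2) the derivative equals −ΣΣ wᵢⱼ (δᵢ − δⱼ)²
  have hEder_eq : ∀ t, ∑ i, K.D i * (2 * δ t i * (-∑ j, w t i j / K.D i * (δ t i - δ t j)))
      = -∑ i, ∑ j, w t i j * (δ t i - δ t j) ^ 2 := by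
    intro t
    have hwsymm : ∀ i j, w t i j = w t j i := fun i j => by
      rw [hw, hw, hsymm, show θ t j - θ t i = -(θ t i - θ t j) by ring, Real.cos_neg]
    rw [sum_sum_mul_sub_sq (w t) hwsymm (δ t), Finset.mul_sum, ← Finset.sum_neg_distrib]
    refine Finset.sum_congr rfl fun i _ => ?_
    have : ∑ j, w t i j / K.D i * (δ t i - δ t j) = (∑ j, w t i j * (δ t i - δ t j)) / K.D i := by
      rw [Finset.sum_div]
      exact Finset.sum_congr rfl fun j _ => by ring
    rw [this]
    field_simp [(hD i).ne']
  -- (3) the bound −ΣΣ w (δᵢ−δⱼ)² ≤ −2 r E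
  have hbound : ∀ t ∈ Icc 0 T,
      -∑ i, ∑ j, w t i j * (δ t i - δ t j) ^ 2 ≤ -(2 * r) * ∑ i, K.D i * δ t i ^ 2 := by
    intro t ht
    -- wᵢⱼ ≥ cos γ · Pᵢⱼ on Δ̄(γ)
    have hwlow : ∀ i j, Real.cos γ * K.P i j ≤ w t i j := fun i j => by
      rw [hw, mul_comm]
      refine mul_le_mul_of_nonneg_left ?_ (hP i j)
      have habs : |θ t i - θ t j| ≤ γ := abs_sub_le_iff.2 ⟨hinv t ht i j, hinv t ht j i⟩
      rw [← Real.cos_abs (θ t i - θ t j)]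
      exact Real.cos_le_cos_of_nonneg_of_le_pi (abs_nonneg _) (by linarith) habs
    have h1 : Real.cos γ * ∑ i, ∑ j, K.P i j * (δ t i - δ t j) ^ 2
        ≤ ∑ i, ∑ j, w t i j * (δ t i - δ t j) ^ 2 := by
      rw [Finset.mul_sum]
      refine Finset.sum_le_sum fun i _ => ?_
      rw [Finset.mul_sum]
      refine Finset.sum_le_sum fun j _ => ?_
      rw [← mul_assoc]
      exact mul_le_mul_of_nonneg_right (hwlow i j) (sq_nonneg _)
    -- connectivity certificate: ΣΣ P (δᵢ−δⱼ)² ≥ (2λ/n) ‖Hδ‖²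
    have h2 : 2 * lam / n * pairNormSq (δ t) ≤ ∑ i, ∑ j, K.P i j * (δ t i - δ t j) ^ 2 := by
      have hn' : (0 : ℝ) < n := by exact_mod_cast hn
      have := hlam (δ t)
      rw [div_mul_eq_mul_div, div_le_iff₀ hn']
      linarith
    -- dihedral angle: (ΣD²) ‖Hδ‖² ≥ κ² Σδ²
    have h3 : K.kappa ^ 2 * ∑ i, δ t i ^ 2 ≤ (∑ i, K.D i ^ 2) * pairNormSq (δ t) := by
      have h0 : ∑ i, K.D i * δ t i = 0 := by
        have := K.sum_D_mul_disagreement hD hφ hsymm (θ t)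
        simpa only [hδ] using this
      exact disagreement_pairNormSq_ge K.D (δ t) h0
    -- E ≤ Dmax Σδ²
    have h4 : ∑ i, K.D i * δ t i ^ 2 ≤ Dmax * ∑ i, δ t i ^ 2 := by
      rw [Finset.mul_sum]
      exact Finset.sum_le_sum fun i _ => mul_le_mul_of_nonneg_right (hDmax i) (sq_nonneg _)
    -- chain: ΣΣ w (δᵢ−δⱼ)² ≥ cos γ (2λ/n) ‖Hδ‖² ≥ cos γ (2λ/n) κ²/(ΣD²) Σδ² ≥ … ≥ 2 r E
    have hP2 : 0 ≤ pairNormSq (δ t) := by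
      unfold pairNormSq
      exact mul_nonneg (by norm_num) (Finset.sum_nonneg fun i _ => Finset.sum_nonneg fun j _ =>
        sq_nonneg _)
    have h5 : 2 * r * ∑ i, K.D i * δ t i ^ 2 ≤ Real.cos γ * (2 * lam / n * pairNormSq (δ t)) := by
      have hn' : (0 : ℝ) < n := by exact_mod_cast hn
      -- 2 r E ≤ 2 r Dmax Σδ² = (2 λ cos γ κ² /(n ΣD²)) Σδ² ≤ (2λ cos γ / n) ‖Hδ‖²
      have s1 : 2 * r * ∑ i, K.D i * δ t i ^ 2 ≤ 2 * r * (Dmax * ∑ i, δ t i ^ 2) :=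
        mul_le_mul_of_nonneg_left h4 (by positivity)
      have s2 : 2 * r * (Dmax * ∑ i, δ t i ^ 2)
          = 2 * lam * Real.cos γ / (n * ∑ i, K.D i ^ 2) * (K.kappa ^ 2 * ∑ i, δ t i ^ 2) := by
        rw [hr]
        field_simp
      have s3 : 2 * lam * Real.cos γ / (n * ∑ i, K.D i ^ 2) * (K.kappa ^ 2 * ∑ i, δ t i ^ 2)
          ≤ 2 * lam * Real.cos γ / (n * ∑ i, K.D i ^ 2) * ((∑ i, K.D i ^ 2) * pairNormSq (δ t)) :=
        mul_le_mul_of_nonneg_left h3 (by positivity)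
      have s4 : 2 * lam * Real.cos γ / (n * ∑ i, K.D i ^ 2) * ((∑ i, K.D i ^ 2) * pairNormSq (δ t))
          = Real.cos γ * (2 * lam / n * pairNormSq (δ t)) := by
        field_simp
      linarith [s1, s2.le, s2.ge, s3, s4.le, s4.ge]
    have h6 := mul_le_mul_of_nonneg_left h2 hcos
    linarith [h1, h5, h6]
  -- (4) Grönwall by monotonicity of F(t) = E(t) e^{2 r t}
  have hF : ∀ t ∈ Icc 0 T, HasDerivWithinAt (fun s => (∑ i, K.D i * δ s i ^ 2) * Real.exp (2 * r * s))
      ((∑ i, K.D i * (2 * δ t i * (-∑ j, w t i j / K.D i * (δ t i - δ t j)))) * Real.exp (2 * r * t)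
        + (∑ i, K.D i * δ t i ^ 2) * (Real.exp (2 * r * t) * (2 * r))) (Icc 0 T) t := by
    intro t ht
    have hexp : HasDerivWithinAt (fun s => Real.exp (2 * r * s)) (Real.exp (2 * r * t) * (2 * r))
        (Icc 0 T) t := by
      have hlin : HasDerivAt (fun s : ℝ => 2 * r * s) (2 * r) t := by
        simpa using (hasDerivAt_id t).const_mul (2 * r)
      exact ((Real.hasDerivAt_exp _).comp t hlin).hasDerivWithinAt
    exact (hEder t ht).mul hexp
  have hF' : ∀ t ∈ Icc 0 T,
      (∑ i, K.D i * (2 * δ t i * (-∑ j, w t i j / K.D i * (δ t i - δ t j)))) * Real.exp (2 * r * t)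
        + (∑ i, K.D i * δ t i ^ 2) * (Real.exp (2 * r * t) * (2 * r)) ≤ 0 := by
    intro t ht
    rw [hEder_eq t]
    have he : 0 < Real.exp (2 * r * t) := Real.exp_pos _
    have hb := hbound t ht
    nlinarith [hb, he]
  have hanti : AntitoneOn (fun s => (∑ i, K.D i * δ s i ^ 2) * Real.exp (2 * r * s)) (Icc 0 T) := by
    apply antitoneOn_of_hasDerivWithinAt_nonpos (convex_Icc 0 T)
    · exact fun t ht => (hF t ht).continuousWithinAt
    · intro t ht
      rw [interior_Icc] at ht
      exact (hF t (Ioo_subset_Icc_self ht)).mono (interior_subset)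
    · intro t ht
      rw [interior_Icc] at ht
      exact hF' t (Ioo_subset_Icc_self ht)
  intro t ht
  have h0T : (0 : ℝ) ∈ Icc 0 T := ⟨le_rfl, ht.1.trans ht.2⟩
  have hmono := hanti h0T ht ht.1
  simp only [mul_zero, Real.exp_zero, mul_one] at hmono
  -- E(t) e^{2rt} ≤ E(0)  ⇒  E(t) ≤ E(0) e^{−2rt}
  have he : 0 < Real.exp (2 * r * t) := Real.exp_pos _
  have hEt : ∑ i, K.D i * δ t i ^ 2 ≤ (∑ i, K.D i * δ 0 i ^ 2) * Real.exp (-(2 * r) * t) := by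
    rw [show -(2 * r) * t = -(2 * r * t) by ring, Real.exp_neg]
    rw [le_mul_inv_iff₀ he]
    exact hmono
  simpa only [hδ] using hEt

/-- **Corollary: every frequency converges exponentially to `Ω`.**  With `E₀ = Σᵢ Dᵢ(θ̇ᵢ(0) − Ω)²`:
`Dᵢ(θ̇ᵢ(t) − Ω)² ≤ E₀ e^{−2λ_fe t}` for each `i` (so `|θ̇ᵢ(t) − Ω| ≤ √(E₀/Dᵢ)·e^{−λ_fe t}`; the printed
`‖δ(t)‖ ≤ √(D_max/D_min)‖δ(0)‖e^{−λ_fe t}`). [cite: DorflerBullo2012, arXiv:0910.5673 §5.1 Thm 5.1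
statement 2) («the frequencies synchronize exponentially to `θ̇_∞ = Ω`») and the last lines of its
proof] -/
theorem frequency_sync_to_syncFreq (hD : ∀ i, 0 < K.D i) (hP : ∀ i j, 0 ≤ K.P i j)
    (hφ : ∀ i j, K.φ i j = 0) (hsymm : ∀ i j, K.P i j = K.P j i)
    {γ lam Dmax T : ℝ} (hγ0 : 0 ≤ γ) (hγ : γ ≤ Real.pi / 2) (hlam0 : 0 ≤ lam)
    (hlam : ∀ v : Fin n → ℝ, lam * pairNormSq v ≤ n * (1 / 2 * ∑ i, ∑ j, K.P i j * (v i - v j) ^ 2))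
    (hDmax : ∀ i, K.D i ≤ Dmax)
    {θ : ℝ → Fin n → ℝ} (hθ : ∀ t ∈ Icc 0 T, HasDerivWithinAt θ (K.field (θ t)) (Icc 0 T) t)
    (hinv : ∀ t ∈ Icc 0 T, θ t ∈ arcPolytope n γ) :
    ∀ t ∈ Icc 0 T, ∀ i, K.D i * (K.field (θ t) i - K.syncFreq) ^ 2
      ≤ (∑ j, K.D j * (K.field (θ 0) j - K.syncFreq) ^ 2) *
        Real.exp (-(2 * (lam * Real.cos γ * K.kappa ^ 2 / (n * (∑ j, K.D j ^ 2) * Dmax))) * t) := by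
  intro t ht i
  have h := K.disagreement_decay hD hP hφ hsymm hγ0 hγ hlam0 hlam hDmax hθ hinv t ht
  have hi : K.D i * (K.field (θ t) i - K.syncFreq) ^ 2
      ≤ ∑ j, K.D j * (K.field (θ t) j - K.syncFreq) ^ 2 :=
    Finset.single_le_sum (f := fun j => K.D j * (K.field (θ t) j - K.syncFreq) ^ 2)
      (fun j _ => mul_nonneg (hD j).le (sq_nonneg _)) (Finset.mem_univ i)
  exact hi.trans h

end NonuniformKuramoto

/-! ### Appendix (gridfusion-lit-1 g5, append 2): frequency synchronization of sparse lossless droop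
networks (Thm 5.1 2) through SPDB2013 Lemma 1) -/

namespace DroopNetwork

variable (N : DroopNetwork n)

/-- **Exponential frequency synchronization of a lossless droop-controlled all-inverter network on a
connected (sparse) graph** — DB2012 Thm 5.1 2) read through SPDB2013 Lemma 1 (`ω = P*`, `Pᵢⱼ = aᵢⱼ`
symmetric `≥ 0`, `φ = 0`): with `Ω = ΣPᵢ*/ΣDᵢ` (`= N.toKuramoto.syncFreq`), a connectivity certificate
`λ‖Hv‖₂² ≤ n·½ΣΣaᵢⱼ(vᵢ−vⱼ)²`, `Dᵢ ≤ D_max`, along every solution on `[0, T]` staying in `Δ̄(γ)`,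
`γ ∈ [0, π/2]` (e.g. by `DroopNetwork.two_norm_cohesive`): the weighted frequency disagreement
`E(t) = ΣDᵢ(θ̇ᵢ(t) − Ω)²`, `θ̇ᵢ = (Pᵢ* − P_{e,i}(θ))/Dᵢ`, satisfies `E(t) ≤ E(0)e^{−2λ_fe t}`,
`λ_fe = λ cos γ (ΣDᵢ)²/(n ΣDᵢ² D_max)`. MODELLED: lossless lines, constant amplitudes, no load buses.
[cite: DorflerBullo2012, arXiv:0910.5673 §5.1 Thm 5.1 statement 2), eq. (rate lambda_fe);
SimpsonporcoDorflerBullo2013, §3 Lemma 1 and Thm 2 (`ω_sync = ω_avg := (ΣPᵢ*)/(ΣDᵢ)`)] -/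
theorem disagreement_decay (hD : ∀ i, 0 < N.Dc i) (ha : ∀ i j, 0 ≤ N.a i j)
    (hasymm : ∀ i j, N.a i j = N.a j i) {γ lam Dmax T : ℝ} (hγ0 : 0 ≤ γ) (hγ : γ ≤ Real.pi / 2)
    (hlam0 : 0 ≤ lam)
    (hlam : ∀ v : Fin n → ℝ, lam * pairNormSq v ≤ n * (1 / 2 * ∑ i, ∑ j, N.a i j * (v i - v j) ^ 2))
    (hDmax : ∀ i, N.Dc i ≤ Dmax)
    {θ : ℝ → Fin n → ℝ} (hsol : ∀ t ∈ Icc 0 T, N.IsSolutionAt θ t)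
    (hinv : ∀ t ∈ Icc 0 T, θ t ∈ arcPolytope n γ) :
    ∀ t ∈ Icc 0 T, ∑ i, N.Dc i * (N.toKuramoto.field (θ t) i - N.toKuramoto.syncFreq) ^ 2
      ≤ (∑ i, N.Dc i * (N.toKuramoto.field (θ 0) i - N.toKuramoto.syncFreq) ^ 2) *
        Real.exp (-(2 * (lam * Real.cos γ * (∑ k, N.Dc k) ^ 2 /
          (n * (∑ i, N.Dc i ^ 2) * Dmax))) * t) := by
  have h := N.toKuramoto.disagreement_decay (γ := γ) (lam := lam) (Dmax := Dmax) (T := T) hD ha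
    (fun _ _ => rfl) hasymm hγ0 hγ hlam0 hlam hDmax
    (fun t ht => N.hasDerivWithinAt_of_isSolutionAt hD (hsol t ht)) hinv
  simpa [NonuniformKuramoto.kappa, toKuramoto] using h

/-- The synchronization frequency of the all-inverter droop network is the «scaled power imbalance»
`Ω = ω_avg = (ΣPᵢ*)/(ΣDᵢ)` (deviation from the nominal `ω*`). [cite: SimpsonporcoDorflerBullo2013, §3
Thm 2 («`ω_avg ≜ (Σᵢ Pᵢ*)/(Σ_{i∈V_I} Dᵢ)`», statement a) `ω_sync = ω_avg`); DorflerBullo2012,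
arXiv:0910.5673 §5.1 Thm 5.1 statement 2)] -/
theorem toKuramoto_syncFreq : N.toKuramoto.syncFreq = (∑ i, N.Pstar i) / ∑ i, N.Dc i := by
  simp [NonuniformKuramoto.syncFreq, NonuniformKuramoto.kappa, toKuramoto]

end DroopNetwork

/-! ### Appendix (gridfusion-lit-1 g5, append 3): the connectivity certificate as a matrix
inequality (Lemma 5.9 ⇐ one PSD check)

Every theorem of this file takes the algebraic connectivity through the hypothesis
`∀ v, λ‖Hv‖₂² ≤ n·½ΣΣaᵢⱼ(vᵢ−vⱼ)²`.  For symmetric `a` this is `vᵀ(n·L(a) − λ·L(Kₙ))v ≥ 0` for all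
`v`, i.e. positive semidefiniteness of ONE explicit `n × n` matrix — the shape the tree's kernel PSD
lane (`Literature.Computation.Certificates.PSD.IsGramCertZ.posSemidef_of_smul`, Gershgorin /
integer Gram certificates) produces.  By Courant–Fischer the largest admissible `λ` is `λ₂(L(a))`
(Lemma 5.9); any certified `λ ≤ λ₂` is admissible. -/

/-- The certificate matrix `Q(a, λ) := n·L(a) − λ·L(Kₙ)` (`L(a)` = Laplacian of the symmetric weights
`aᵢⱼ`, self-weights ignored; `L(Kₙ) = nI − 𝟙𝟙ᵀ`):
`Q(a,λ)ᵢᵢ = n·Σ_{k≠i} aᵢₖ − λ(n − 1)`, `Q(a,λ)ᵢⱼ = −n·aᵢⱼ + λ` (`i ≠ j`).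
[cite: DorflerBullo2012, arXiv:0910.5673 §5.2 Lemma 5.9 (the inequality
`(Bx)ᵀdiag(Aᵢⱼ)(Bx) ≥ (λ₂(L(Aᵢⱼ))/n)‖Hx‖₂²` it certifies)] -/
def connectivityMatrix (a : Fin n → Fin n → ℝ) (lam : ℝ) : Matrix (Fin n) (Fin n) ℝ :=
  Matrix.of fun i j =>
    (n : ℝ) * ((if i = j then ∑ k, a i k else 0) - a i j) - lam * ((if i = j then (n : ℝ) else 0) - 1)

/-- The quadratic form of the certificate matrix:
`vᵀQ(a,λ)v = n·½ΣΣaᵢⱼ(vᵢ−vⱼ)² − λ‖Hv‖₂²` (symmetric `a`). [cite: DorflerBullo2012, arXiv:0910.5673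
§5.2 Lemma 5.9 and its proof («`L(Aᵢⱼ) = Bᵀdiag(Aᵢⱼ)B`», «`‖Hx‖₂² = n‖x_⊥‖²`-type identities»)] -/
theorem connectivityMatrix_quadForm (a : Fin n → Fin n → ℝ) (ha : ∀ i j, a i j = a j i) (lam : ℝ)
    (v : Fin n → ℝ) :
    dotProduct v ((connectivityMatrix a lam).mulVec v)
      = n * (1 / 2 * ∑ i, ∑ j, a i j * (v i - v j) ^ 2) - lam * pairNormSq v := by
  -- row `i` of `Q v`
  have hrow : ∀ i, (connectivityMatrix a lam).mulVec v i
      = n * ∑ j, a i j * (v i - v j) - lam * (n * v i - ∑ j, v j) := by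
    intro i
    simp only [Matrix.mulVec, dotProduct, connectivityMatrix, Matrix.of_apply]
    have h1 : ∑ j, ((n : ℝ) * ((if i = j then ∑ k, a i k else 0) - a i j)
        - lam * ((if i = j then (n : ℝ) else 0) - 1)) * v j
        = ∑ j, (if i = j then ((n : ℝ) * (∑ k, a i k) * v j - lam * n * v j) else 0)
          + ∑ j, (-(n : ℝ) * a i j * v j + lam * v j) := by
      rw [← Finset.sum_add_distrib]
      exact Finset.sum_congr rfl fun j _ => by split_ifs <;> ring
    rw [h1, Finset.sum_ite_eq Finset.univ i, if_pos (Finset.mem_univ i)]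
    have h2 : ∑ j, (-(n : ℝ) * a i j * v j + lam * v j)
        = -(n : ℝ) * ∑ j, a i j * v j + lam * ∑ j, v j := by
      rw [Finset.mul_sum, Finset.mul_sum, ← Finset.sum_add_distrib]
      exact Finset.sum_congr rfl fun j _ => by ring
    have h3 : ∑ j, a i j * (v i - v j) = (∑ k, a i k) * v i - ∑ j, a i j * v j := by
      rw [Finset.sum_mul, ← Finset.sum_sub_distrib]
      exact Finset.sum_congr rfl fun j _ => by ring
    rw [h2, h3]
    ring
  -- assemble
  simp only [dotProduct]
  simp_rw [hrow]
  have h4 : ∑ i, v i * (n * ∑ j, a i j * (v i - v j) - lam * (n * v i - ∑ j, v j))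
      = n * ∑ i, v i * ∑ j, a i j * (v i - v j) - lam * (n * ∑ i, v i ^ 2 - (∑ i, v i) ^ 2) := by
    have : ∀ i, v i * (n * ∑ j, a i j * (v i - v j) - lam * (n * v i - ∑ j, v j))
        = n * (v i * ∑ j, a i j * (v i - v j)) - lam * (n * v i ^ 2) + lam * (v i * ∑ j, v j) :=
      fun i => by ring
    simp_rw [this]
    rw [Finset.sum_add_distrib, Finset.sum_sub_distrib, ← Finset.mul_sum, ← Finset.mul_sum,
      ← Finset.mul_sum, ← Finset.mul_sum, ← Finset.sum_mul, sq (∑ i, v i)]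
    ring
  rw [h4, sum_sum_mul_sub_sq a ha v, pairNormSq_eq]
  ring

/-- **One PSD check certifies the connectivity hypothesis.**  If the quadratic form of
`Q(a, λ) = n·L(a) − λ·L(Kₙ)` is nonnegative (e.g. from `Matrix.PosSemidef`, or from the tree's integer
Gram certificates), then `λ‖Hv‖₂² ≤ n·½ΣΣaᵢⱼ(vᵢ−vⱼ)²` for all `v` — the hypothesis `hlam` of
`lyapW_deriv_le`, `lyapW_sublevel_invariant`, `two_norm_cohesive`, `disagreement_decay`,
`DroopNetwork.two_norm_cohesive`, `DroopNetwork.disagreement_decay`. [cite: DorflerBullo2012,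
arXiv:0910.5673 §5.2 Lemma 5.9 (Courant–Fischer: the best constant is `λ₂(L(a))`)] -/
theorem connectivity_certificate_of_quadForm_nonneg (a : Fin n → Fin n → ℝ)
    (ha : ∀ i j, a i j = a j i) (lam : ℝ)
    (hQ : ∀ v : Fin n → ℝ, 0 ≤ dotProduct v ((connectivityMatrix a lam).mulVec v)) :
    ∀ v : Fin n → ℝ, lam * pairNormSq v ≤ n * (1 / 2 * ∑ i, ∑ j, a i j * (v i - v j) ^ 2) := by
  intro v
  have h := hQ v
  rw [connectivityMatrix_quadForm a ha lam v] at h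
  linarith

/-- The same from Mathlib's `Matrix.PosSemidef`. [cite: DorflerBullo2012, arXiv:0910.5673 §5.2
Lemma 5.9] -/
theorem connectivity_certificate_of_posSemidef (a : Fin n → Fin n → ℝ)
    (ha : ∀ i j, a i j = a j i) (lam : ℝ) (hQ : Matrix.PosSemidef (connectivityMatrix a lam)) :
    ∀ v : Fin n → ℝ, lam * pairNormSq v ≤ n * (1 / 2 * ∑ i, ∑ j, a i j * (v i - v j) ^ 2) :=
  connectivity_certificate_of_quadForm_nonneg a ha lam fun v => by
    simpa using hQ.dotProduct_mulVec_nonneg v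

end Literature.MathematicalPhysics.PowerSystems
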